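import Summits.CriticalPhenomena.Ising3DConformalLimit.Theorems.EnergyNotSigmaSquaredGapForcesFarMergingReduction
import Summits.CriticalPhenomena.Ising3DConformalLimit.Theorems.GapForcesFarMerging.Negative.DegenerateInstances
import Summits.CriticalPhenomena.Ising3DConformalLimit.Theorems.GapForcesFarMerging.Negative.AvoidanceApriori

/-!
# Disproof of `GapForcesFarMerging` — the standing adversary's work file
# (crux `stmt-CriticalPhenomena-4468`, route `EnergyNotSigmaSquared`, rank 2 "TRANSFER")

`GapForcesFarMerging := EnergyGapPowerLaw → FarMerging`: IF the truncated critical energy–energy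
correlation on `ℤ³` obeys `⟨σ₀σ_{e₂} ; σ_xσ_{x+e₂}⟩_{β_c} ≤ C‖x‖^{-κ}⟨σ₀σ_x⟩²` for some `κ > 0` (GAP,
"ε is not σ²", adjacent-source current avoidance decays as a power) THEN for some `c > 0` and some
injective lattice quadruple `x`, `U₄(Lx) ≤ -c⟨σ_{Lx₀}σ_{Lx₁}⟩⟨σ_{Lx₂}σ_{Lx₃}⟩` along infinitely many
dilations `L` (far merging, Aizenman's intersection criterion at macroscopic separation).

## Findings (v13 = generation 4, cycle 1; `lean check` rc 0, no `sorry`, axioms {propext, Classical.choice, Quot.sound})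

NEW IN v13 (generation 4; §9–§10 at the end of the file, all checked): the line is down to ONE
statement, `QuasiMultiplicativeShape cc2 (criticalCorr 3 4)` (lead: `gapForcesFarMerging_of_quasiMultiplicative`,
promote-stub recommended). Two new kernel-checked facts about that statement.
(§9, CONVERSE NO-GO) stub 4 is NOT NECESSARY: family E (`θ_{A′}` on the nearest-neighbour stratum,
`1/2` in the bulk) has every line input (package, GAP, isosceles RP, envelope, SPL, SPP) AND far
merging (thin shapes included, `thinMerging_E`), yet violates QM and dyadic QM
(`quasiMultiplicative_not_forced_by_farMerging`): uniform quasi-multiplicativity from below fails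
precisely in strongly-merging worlds, so it over-shoots the crux. (§10, THE EXACT CONSUMPTION) the
iteration uses QM only across octave blocks where the opened strands do NOT merge:
`PinchedTransparencyShape` (stub 4′) — implied by QM and by dyadic QM (`transparency_of_qmDyadic`),
sufficient (`scaleIteration_soft_transparent`, `gapForcesFarMerging_of_transparency_stubs`; in the
tree modulo the landed stubs: `Negative.TransparentPassage.gapForcesFarMerging_of_transparency`),
not soft (`pinchedTransparency_false_without_model`, A′), and — unlike QM — satisfied by family E
(`pinchedTransparency_E`); and its sequence form ST = `SlowPinchUnderTransparencyShape` ("far-field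
transparency on the thin dyadic shapes ⟹ pinch exponent zero"), sufficient WITHOUT positivity
(`gapForcesFarMerging_of_slowPinch`), not soft, E-compatible (`stub4_taxonomy` is the one-theorem summary). Recommended replacement target for the lead / the promoted crux: PT, whose
content is separation + source-Harnack for one passage ONLY against a transparent (non-merging)
far background. Landing copies proposed: `Negative/FarMergingWithoutQM.lean`, `Negative/TransparentPassage.lean`.


FILE LAYOUT FROM v13 ON (restructure forced by the 200 kB work-file cap): §0–§7 of v6–v12 are
LANDED and importable, so this file now IMPORTS them instead of re-declaring them, and carries in-line
only what is not yet in the tree (§9, §10) plus the prose record (§8 numerics, the findings below).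
Where the sections live (namespace `Summit.CriticalPhenomena.Ising3DConformalLimit.Theorems.GapForcesFarMerging.Negative`,
modules `Summits.….Theorems.GapForcesFarMerging.Negative.<M>`): §0 anatomy → `SoftShapes`
(`crux_iff`, `not_crux_iff`, `energyGapPowerLaw_iff_adjacentWickDefect`, `adjacent_ursell_sandwich_of_gap`,
`energyGapSoft_of_energyGapPowerLaw`); §2 package + kernel → `SoftShapes`/`SoftKernel`
(`SoftPackage`, `ThetaHyp`, `softPackage_Fθ_core`, `S₀`, `g`, `wick`, `pmin`, `sep`, `Fθ`); §3 families
A, B, C → `SoftFamilies` (`gapShape_A`, `not_farMergingShape_A`, `farMergingShape_B`, `not_gapShape_B`,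
`FC_eq_FA_of_two_le_sep`, `not_summable_S₀_sq`); §4 verdicts → `SoftVerdicts`
(`gapForcesFarMerging_false_without_model`, `farMergingForcesGap_false_without_model`,
`gapShape_not_determined_by_bulk`, `oneEndedGapForcesFarMerging_false_without_model`); §5 RP lever →
`NotRP` (`familyA_not_rpCauchySchwarz`); §6 Ising certificate → `IsingCertificate`
(`softPackageNoBubble_criticalCorr`); §7 line shapes / family A′ / verdicts / iteration →
`LineShapes` (`RPUnpinchShape`, `RPUnpinchIsoShape`, `UnpinchedEnvelopeShape`, `SinglePinchLawShape`,
`SinglePinchPositiveShape`, `QuasiMultiplicativeShape`, the `…_criticalCorr_iff` lemmas), `LineFamily`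
(`θA'`, `FA'`, `evals_w/v/u/x`, `TS_w`, `TS_v`, `pairpair_u`, `gapq_x`), `LineVerdicts`
(`quasiMultiplicative_false_without_model`, `lineInputs_without_QM_and_farMerging`, `avoid_w`, `avoid_v`),
`ScaleIterationDyadic` (`QuasiMultiplicativeDyadicShape`, `qmDyadic_of_qm`, `scaleIteration_soft_dyadic`,
`gapForcesFarMerging_of_three_stubs(')`, `singlePinchLaw_of_gap_and_isoRP`,
`quasiMultiplicativeDyadic_false_without_model`); drefute's degenerate instances → `DegenerateInstances`;
a-priori bounds `0 ≤ 𝒜 ≤ 2`, `Q ≥ 𝒜(e₂;m)/4` → `AvoidanceApriori`; the lead's landed stubs and the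
reduction `gapForcesFarMerging_of_quasiMultiplicative(Dyadic)` → module
`Summits.….Theorems.EnergyNotSigmaSquaredGapForcesFarMergingReduction` (namespace
`….EnergyNotSigmaSquaredGapForcesFarMerging`). The v12 text (2982 lines, all of §0–§8 in-line) is the
evidence attachment `20260816T014124Z-Disproof.lean` of the item.

NEW IN v12 (generation 3, later the same night): the LEAD has landed stub 5 (adapted from §7:
`Theorems/EnergyNotSigmaSquaredGapForcesFarMergingScaleIteration.lean`, `stub_scaleIteration`) and
stub 2 (`…UnpinchedEnvelope.lean`, `stub_unpinchedEnvelope`); §7 now carries the SHARPER soft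
iteration `scaleIteration_soft_dyadic` (hypothesis `QuasiMultiplicativeDyadicShape`: pairs
`(2^i,2^{i+ℓ})` only, defect `c(ℓ) ≥ 2^{-o(ℓ)}`, finitely many exceptional `i` — what the
iteration really consumes; `qmDyadic_of_qm`), and §8 (docblock at the end) records the numerics of
the reflection-positivity question: over the ℓ¹ kernel `1/(1+|x|₁)` (a reflection-positive
two-point function) family A passes every tested RP–Cauchy–Schwarz inequality of the pair sector.
Landed so far: `Negative/LineShapes` (p72660), `LineFamily` (p73083), `LineVerdicts` (p73485:
`quasiMultiplicative_false_without_model`); `ScaleIterationDyadic` proposed.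

NEW IN v11 (§7 at the end of the file, ~1100 lines, all checked): the registered skeleton
`Lines/rp-unpinch-single-passage.lean` is audited stub by stub. (1) `scaleIteration_soft` PROVES
stub 5 over the soft package (so `scaleIteration_criticalCorr` is the registered
`stub_scaleIteration` verbatim and `gapForcesFarMerging_of_four_stubs` derives the crux from stubs
1–4); (2) family A′ = A with `θ` lowered by the factor `1 − min(1,sep)·Pmin` has package + GAP +
single-pinch law + STRICT single-pinch positivity + un-pinched envelope + the isosceles RP minors,
and violates quasi-multiplicativity and far merging: `quasiMultiplicative_false_without_model` —
stub 4 is exactly where the model must enter, nothing else in the line constrains it; (3) stubs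
1–3 are Ising-true (paper audit in §7's docblock), unkillable. Proposed for landing as
`Negative/{LineShapes,LineFamily,LineVerdicts,ScaleIteration}.lean`.

LANDED (importable) copies of everything below, namespace
`Summit.CriticalPhenomena.Ising3DConformalLimit.Theorems.GapForcesFarMerging.Negative`, modules
`Summits.CriticalPhenomena.Ising3DConformalLimit.Theorems.GapForcesFarMerging.Negative.{SoftShapes,
SoftKernel, SoftFamilies, SoftVerdicts, IsingCertificate, NotRP}` (gate p70261, p70642, p70717,
p71522, p71524, p71525; 2026-08-15/16). Import `…Negative.SoftVerdicts` for the no-go theorems,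
`…Negative.IsingCertificate` for `softPackageNoBubble_criticalCorr`, `…Negative.NotRP` for
`familyA_not_rpCauchySchwarz`. (There the closed propositions `FarMerging` /
`GapForcesFarMergingWithoutModel` are inlined as `FarMergingShape cc2 (criticalCorr 3 4)` / an
explicit `∀`, because closed `def : Prop` in Theorems files are relocated to Literature by the gate.)

Versions v1–v5 (generation 1, 2026-08-15T22:22–22:42Z) live only in the gate evidence store
(`run/gate/evidence/stmt-CriticalPhenomena-4468/…-Disproof.lean`, plus `WeakGapKappaZero.lean`),
which is not mounted in the seats' jails; this v6 is a self-contained successor written from their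
evidence notes. Gen-1 theorem names, for provers who can read that store: `not_crux_iff`,
`not_transfer_of_looksLikeIsing` (family `W`), `weakGap_criticalCorr` (κ = 0 GAP is a theorem:
`⟨ε₀;ε_x⟩ ≤ (1+G(e₂)⁻²)G(x)²`), `cruxWithoutKappaPos_iff` (dropping `0 < κ` collapses the crux to its
conclusion), `U4_criticalCorr_eq` (`U₄ = -2GG·P[merge]`), `farMergingFor_criticalCorr_iff_merge`,
`farMerging_const_le_two` (c ≤ 2), `gapHyp_unsat_without_ne_zero` (the guard `x ≠ 0` is needed:
`⟨ε₀;ε₀⟩ = 1 - G(e₂)² > 0`), `io_ge_of_prod_le_two_pow` / `io_ge_needs_lt_one` /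
`density_of_prod_le_two_pow` (Step 1 of the intended proof — GAP ⇒ per-annulus conditional merging
`m_k ≥ c` infinitely often — is soft and proved; "positive density of scales" needs the extra input
`m_k ≤ 1 - δ`), family `W'` (two-sided power law, strict Lebowitz, still no far merging).

### §0 Anatomy (what a disproof would be) and two reformulations of the real statement

* `crux_iff`, `crux_iff_shapes`, `energyGapPowerLaw_iff_gapShape`, `farMergingGivesU4_iff`
  (all `Iff.rfl`): the crux is literally `GapShape cc2 (criticalTwoPoint 3) (criticalCorr 3 4) →
  FarMergingShape cc2 (criticalCorr 3 4)`, and its conclusion `FarMerging` is verbatim the hypothesis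
  of item 4471 `FarMergingGivesU4`. `not_crux_iff`: a disproof is exactly
  `EnergyGapPowerLaw ∧ ¬FarMerging` — the open, predicted-TRUE item 4469 together with LATTICE
  GAUSSIANITY `U₄(Lx) = o(⟨σσ⟩⟨σσ⟩)` along every dilation of every injective shape, which is predicted
  FALSE (Ising₃ is interacting; `U₄^cont < 0` on an open dense set by Lebowitz + real analyticity, and
  an integer quadruple with `U₄^cont(x) < 0` gives FarMerging once the pointwise limit exists).
  There is no junk to exploit: `criticalCorr 3 n` are genuine limits (`criticalCorr_wellDefined_holds`),
  `‖·‖` on `Site 3 = Fin 3 → ℤ` is the sup norm, the guard `x ≠ 0` keeps `‖x‖^{-κ}` honest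
  (`one_le_norm_of_ne_zero`), coincidences `x = ±e₂` are absorbed by `C`, and `L = 0` is reachable only
  for `L₀ = 0`. **Verdict: irrefutable as a concrete statement; it resists because its conclusion is
  (believed) true, and it is exactly as hard as its mechanism.**
* `energyGapPowerLaw_iff_adjacentWickDefect` (real model, proved): with
  `W(x) := ⟨σ₀σ_x⟩⟨σ_{e₂}σ_{x+e₂}⟩ + ⟨σ₀σ_{x+e₂}⟩⟨σ_{e₂}σ_x⟩` (the two CROSS Wick terms), GAP reads
  `W(x) + U₄(0,e₂,x,x+e₂) ≤ C‖x‖^{-κ}G(x)²`: the hypothesis is NEAR-SATURATION `|U₄| ≈ W` of the Wick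
  envelope on the codimension stratum `{y : y₁ - y₀ = y₃ - y₂ = e₂}` of `(ℤ³)⁴`, the conclusion is
  `|U₄| ≥ c⟨σσ⟩⟨σσ⟩` on dilated bulk quadruples — one function `U₄`, two strata.
  `adjacent_ursell_sandwich_of_gap` adds the Lebowitz sign (`criticalUrsellFour_nonpos`).
* `energyGapSoft_of_energyGapPowerLaw`: item 4469 ⇒ item 4473 (the soft milestone), a cheap glue
  provers may cite.

### §2–§4 Load-bearing analysis: THE MODEL IS LOAD-BEARING (`_false_without_` theorems)

The crux has a single hypothesis, GAP, and dropping it leaves FarMerging itself (open), so the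
`_false_without_<H>` analysis is run on the only other input a proof can use: the identity of the
correlators. `SoftPackage S T F` collects 22 properties of the triple
(`cc2`, `criticalTwoPoint 3`, `criticalCorr 3 4`) that are TRUE for the critical Ising model on `ℤ³`,
most of them PROVED in the tree in infinite volume — pair symmetry and translation invariance
(`criticalCorr_two_pair[_comm]`), hyperoctahedral invariance (`twoPointPlus_perm_invariant_holds`,
`twoPointPlus_reflection_invariant_holds`), `⟨σ₀σ₀⟩ = 1`, `0 < ⟨σ₀σ_x⟩ ≤ 1`, the `ℤ³` bounds
`c‖x‖⁻² ≤ ⟨σ₀σ_x⟩ ≤ C‖x‖⁻¹` (`criticalTwoPoint_bounds_holds`), Messager–Miracle-Solé in the form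
`3‖v‖ ≤ ‖w‖ ⇒ G(w) ≤ G(v)`, GKS II on pairs `G(a,b)G(b,c) ≤ G(a,c)`, bubble divergence
`Σ_x⟨σ₀σ_x⟩² = ∞` (Duminil-Copin–Panis 2025, Thm 1.8), permutation symmetry and translation invariance
of the four-point function, `σ² = 1` at coincident points, GKS I/II (`0 ≤ F`, `⟨σσ⟩⟨σσ⟩ ≤ F`),
Lebowitz `U₄ ≤ 0` (`criticalUrsellFour_nonpos`) and Aizenman's random-current bound
`-2⟨σ_{y₀}σ_{y₁}⟩⟨σ_{y₂}σ_{y₃}⟩ ≤ U₄` (`abs_criticalUrsellFour_le_two_mul`; with the symmetries this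
is `0 ≤ P[merge] ≤ 1` in all three pairings — everything the exact dictionary `U₄ = -2GG·P[merge]`
says about ONE quadruple at a time).

Explicit families on `ℤ³` (kernel `S₀(a,b) = 1/(1 + ‖b-a‖_∞)`, four-point
`F_θ = Wick - 2·Pmin·θ`, i.e. `U₄ = -2·Pmin·θ` with `Pmin` the smallest pairing product and
`θ ∈ [0,1]` a symmetric "merging probability"; `softPackage_Fθ_core`: EVERY such `θ` equal to `1`
at coincidences gives the full package):

* family A, `θ_A = 1/max(1, sep)` (`sep` = minimal pairwise sup-distance): `gapShape_A` (GAP with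
  `κ = 1`, `C = 36`; on the adjacent stratum `θ_A = 1` and the energy truncation is
  `|g(x)² - g(x+e₂)g(x-e₂)| ≤ 3‖x‖⁻¹g(x)²`), `not_farMergingShape_A` (`U₄(Lx)/(⟨⟩⟨⟩) = O(1/L)` on
  every shape) ⇒ **`gapForcesFarMerging_false_without_model : ¬ GapForcesFarMergingWithoutModel`**.
  Any proof of the crux must use a property of `criticalCorr 3` outside the package; in particular
  no combination of correlation inequalities, two-point asymptotics and the one-quadruple dictionary
  `P[merge] ∈ [0,1]` suffices. What is missing is a COUPLING between quadruples of different shape /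
  scale — exactly the separation + cross-scale decoupling lemmas for SOURCED double currents that the
  planner bets on and that do not exist on `ℤ³` (ADC21 §6 is `d = 4`, sourceless).
* family B, `θ_B = 1` at coincidences and `1/2` elsewhere: `farMergingShape_B` (`c = 1/9`, collinear
  shape `(0,e₂,2e₂,3e₂)`, EVERY `L ≥ 1`), `not_gapShape_B` ⇒
  **`farMergingForcesGap_false_without_model`**: the converse transfer ("uniform far merging ⇒ κ > 0",
  card A6 of the route) is not soft either; GAP and FarMerging are logically independent over the
  package.
* family C, `θ_C = θ_A` off the nearest-neighbour stratum `{sep = 1}` and `1/2` on it: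
  `FC_eq_FA_of_two_le_sep`, `FC_eq_FA_smul` (C = A on every quadruple with pairwise distances ≥ 2,
  in particular on every dilation `L ≥ 2` of every injective shape), `not_gapShape_C`,
  `not_farMergingShape_C` ⇒ **`gapShape_not_determined_by_bulk`**: GAP is a lattice-distance-1 datum
  INVISIBLE to everything a pointwise scaling limit of the four-point function can see (same rescaled
  limits, same bulk `U₄`, same package, opposite GAP verdicts). FarMerging, on the contrary, follows
  from the bulk as soon as the pointwise limit exists with `U₄^cont(x) < 0` at one integer quadruple.
  So no argument of the form "soft package + any continuum/CFT structure of the SPIN correlators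
  (existence, Möbius covariance, OPE of the limit family `S`)" proves the crux: the coupling of the
  distance-1 avoidance event to the bulk has to be done ON THE LATTICE.
* `not_summable_S₀_sq`: the explicit kernel has a divergent bubble (restriction to the plane
  `(i,j,0)` and the planar harmonic series), so bubble divergence — the `d = 3` feature feeding
  RungOneAdjacentMerging — is inside the package and still does not transfer.

### §5 Levers outside the package (round-1 crux ideas) and their residual cruxes

* Reflection positivity (cards `rp-unpinch-single-passage`, `rp-gram-halving`) is a genuine
  cross-geometry coupling: RP–Cauchy–Schwarz across a bond mirror with `F = ε_b - ⟨ε_b⟩` turns GAP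
  into a ONE-ENDED gap (adjacent sources, far-apart targets) with exponent `κ/2`. The package does
  not contain RP and families A–C are not claimed reflection positive: §4 does not touch that lever.
  But CS exports only UPPER bounds on truncations containing the energy bond (off-diagonal ≤
  diagonal; the bond is the only GAP-small diagonal observable), so it reaches "2+1+1", never the
  lower bound on `|U₄|` at a spread quadruple.
* `OneEndedGapShape`, `oneEndedGapShape_A` (family A has the one-ended gap for ALL far target pairs,
  exponent `1`, in the cross-Wick normalisation), `oneEndedGapForcesFarMerging_false_without_model`:
  the un-pinched residual (`C⁺ = SinglePinchForcesFarMerging`, `OneEndedGap → FarMerging`) is not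
  soft either — same witness, same missing coupling, now for one passage `1 → R`.
* `familyA_not_rpCauchySchwarz`: family A VIOLATES the RP–Cauchy–Schwarz minor across the site
  mirror `y₁ ↦ 10 - y₁` (`⟨ε_b;ε_{θb}⟩_A = 0` on the `e₁` axis while `⟨ε_b;σ_{θp}σ_{θq}⟩_A =
  1/140 - 1/147`), so reflection positivity is GENUINELY outside the package: an RP-positive family
  with GAP and no far merging is the next, sharper no-go to build (open).

### Why the crux resists DISPROOF (and where a proof must happen)

* In every solved regime GAP and FarMerging have the SAME truth value: `d = 2` both true
  (`κ = 3/2`, Δ_ε = 1, Δ_σ = 1/8; `U₄^cont ≢ 0`, Chelkak–Hongler–Izyurov); `d ≥ 5`, `d = 4`,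
  reflection-positive long range `α ≤ 3/2` on `ℤ³`: both false (finite or log-divergent bubble ⇒
  adjacent strands avoid with probability `≥ c` resp. `≥ c/log`, AND Gaussian limit; barrier files
  `IsingTrivialityFromDimensionFour`, `LongRangeTrivialityOnZ3`). A counterexample to the implication
  needs GAP ∧ Gaussian bulk — no known ferromagnet does that, and for n.n. `ℤ³` it contradicts the
  conformal-bootstrap picture (Δ_ε - 2Δ_σ ≈ 0.376 AND λ_σσε ≠ 0).
* Continuum heuristics do NOT upgrade to a proof, and family C is the formal shadow of why: if the
  spin four-point limit were generalised free, its conformal block decomposition would force a scalar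
  `[σσ]₀` of dimension exactly `2Δ_σ` in `σ × σ`; GAP says the LATTICE energy density does not couple
  to anything of dimension `≤ 2Δ_σ`; the contradiction needs "the lattice energy couples to the lowest
  `ℤ₂`-even scalar of `σ × σ`", a genericity statement about a composite lattice operator that no
  axiom on `S` provides (C decouples the stratum from the bulk by fiat and keeps every listed
  property).
* Rigorous handles that do NOT bite: the Aizenman–Graham inequality (tree:
  `AizenmanGrahamInequality.lean`, finite volume) bounds `|U₄|` from ABOVE by bubble × `∂_J⟨σσ⟩`
  terms, the wrong direction for FarMerging; no lower bound on `|U₄|` beyond `0` is known on `ℤ³` at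
  any scale (that is non-triviality itself); GAP sums to "specific heat partial sums grow at most like
  `R^{1-κ}`", consistent with α ≈ 0.11 and with the bubble bound on the specific heat (Sokal), no
  tension.
* Attempts of this cycle that failed to bite the concrete statement: quantifier degeneracies
  (`L = 0`, `x = ±e₂`, collinear / non-generic shapes, the `∃ x` after `∃ c`), the sup-norm vs
  Euclidean normalisation (`G(x±e₂)/G(x) ∈ [G(e₂), G(e₂)⁻¹]` by GKS, so `G(x)²` vs cross-Wick is
  immaterial), dimension / range shifts (above), the pigeonhole over dyadic shapes (needs a
  source-displacement Harnack input — gen-1 §7 (H) — but that is a gap in the intended PROOF, not a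
  counterexample).

### §6 The package is Ising-true (certificate)

* `softPackageNoBubble_criticalCorr : SoftPackageNoBubble cc2 (criticalTwoPoint 3) (criticalCorr 3 4)`:
  EVERY field of the package except bubble divergence is a theorem of the tree for the critical
  Ising model on `ℤ³` (translation invariance via `plusExpect_spinProduct_comp_shift` +
  `ising_fkg_holds`; GKS I/II with multiplicities via `plusCorr_nonneg` / `plusCorr_mul_le` and
  `σ² = 1`; MMS in the sup norm via `twoPointPlus_le_of_mul_supNorm_le`; the `ℤ³` bounds via
  `criticalTwoPoint_bounds_holds`; Lebowitz / Aizenman via `CriticalUrsellFourSign`);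
  `softPackage_iff_noBubble_and_bubble`. Bubble divergence is DCP25 Thm 1.8 (true, printed; in
  tree only inside the named fact `LaceExpansionIsingAboveFourNarrow`). So §4–§5 quantify over a
  class that provably contains `criticalCorr 3` up to one printed theorem.

### Not formalised here (next cycle candidates)

* A package field encoding the Aizenman–Graham inequality or the Simon–Lieb propagation bound: both
  are satisfied by family A with room (`γ > 1`-type slack `‖x‖^{1-κ}` at the adjacent stratum thanks
  to the linear bubble), so they would not change the verdicts; omitted to keep the file finite.
* Reflection positivity of families A–C is NOT claimed (and is false for A: `familyA_not_rpCauchySchwarz`);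
  A′ (§7) satisfies the ISOSCELES RP minors (all that the skeleton's glue consumes) and, numerically,
  the instance that kills A (`(y,z) = ((6,20,0),(6,0,0))`, `m = 5`: LHS 9.8e-7 ≤ RHS 1.7e-4 for the
  `1/(1+diam)` variant). Whether an A′-type family satisfies ALL minors of `RPUnpinchShape` (∀ m y z)
  is open: if yes, two-observable RP–Cauchy–Schwarz provably never yields quasi-multiplicativity —
  the sharper no-go; the sup-norm degeneracies make the ∀-verification a large case analysis
  (AM–GM-tight in the adjacent-targets case `z = y + e₂`: `(1+2m)(1+2h) ≤ (1+m+h)²`).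
* An Ising-side proof of stub 2 (`UnpinchedEnvelope`) from `criticalCorr_griffiths`,
  `criticalUrsellFour_nonpos`, `messager_miracleSole_holds` (coordinate monotonicity
  `G((2m,2m,0)) ≤ G((2m,0,0))`) and `twoPointPlus_reflection_invariant_holds` — positive, for the lead.
-/

noncomputable section

namespace Summit.CriticalPhenomena.Ising3DConformalLimit.Cruxes.GapForcesFarMerging.Disproof

open Literature.Probability.LatticeModels
open Summit.CriticalPhenomena.Ising3DConformalLimit.Theses.EnergyNotSigmaSquared
open Summit.CriticalPhenomena.Ising3DConformalLimit.Theorems.GapForcesFarMerging.Negative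
open Summit.CriticalPhenomena.Ising3DConformalLimit.EnergyNotSigmaSquaredGapForcesFarMerging
  (rpUnpinchShape_criticalCorr rpUnpinchIsoShape_criticalCorr singlePinchPositiveShape_criticalCorr
    singlePinchLawShape_of_gap gapForcesFarMerging_of_quasiMultiplicative
    gapForcesFarMerging_of_quasiMultiplicativeDyadic)
open Summit.CriticalPhenomena.Ising3DConformalLimit.EnergyNotSigmaSquaredGapForcesFarMerging.ScaleIteration
  (NparS_pos half_lt_avoidS_of_not_merge avoidS_dyadic_le exists_good_scale F_perm_dsu)

/-! # §0–§7: landed (see the FILE LAYOUT paragraph above); the state of the line in one theorem -/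

/-- **Where the crux stands (kernel-checked, importable):** `GapForcesFarMerging` follows from
one-passage quasi-multiplicativity of the critical single-pinch avoidance functional ALONE, and even
from its dyadic sub-exponential-defect weakening (lead's reduction over the landed stubs 1, 2, 3, 5). [folklore] -/
theorem crux_of_quasiMultiplicative_landed :
    (QuasiMultiplicativeShape cc2 (criticalCorr 3 4) → GapForcesFarMerging) ∧
      (QuasiMultiplicativeDyadicShape cc2 (criticalCorr 3 4) → GapForcesFarMerging) :=
  ⟨gapForcesFarMerging_of_quasiMultiplicative, gapForcesFarMerging_of_quasiMultiplicativeDyadic⟩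

/-- **And quasi-multiplicativity is where the model must enter** (landed no-go theorems, restated):
neither the uniform nor the dyadic form follows from the soft package + GAP + isosceles RP + envelope +
single-pinch law + strict positivity. [folklore] -/
theorem quasiMultiplicative_not_soft_landed :
    (¬ ∀ (S : Site 3 → Site 3 → ℝ) (T : Site 3 → ℝ) (F : (Fin 4 → Site 3) → ℝ),
      SoftPackage S T F → GapShape S T F → RPUnpinchIsoShape S F → UnpinchedEnvelopeShape S T F →
        SinglePinchLawShape S T F → SinglePinchPositiveShape S F → QuasiMultiplicativeShape S F) ∧
    (¬ ∀ (S : Site 3 → Site 3 → ℝ) (T : Site 3 → ℝ) (F : (Fin 4 → Site 3) → ℝ),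
      SoftPackage S T F → GapShape S T F → RPUnpinchIsoShape S F → UnpinchedEnvelopeShape S T F →
        SinglePinchLawShape S T F → SinglePinchPositiveShape S F → QuasiMultiplicativeDyadicShape S F) :=
  ⟨quasiMultiplicative_false_without_model, quasiMultiplicativeDyadic_false_without_model⟩

/-! # §9 (generation 4) Far merging WITHOUT quasi-multiplicativity: stub 4 asserts more than the crux needs

QUESTION (converse): with stubs 1, 2, 3, 5 landed the crux is `⇐ QuasiMultiplicativeShape` — is
stub 4 also NECESSARY, i.e. does far merging + every other line input force it, at least softly?
NO: family E (`θ_E = θ_{A′}` on `{sep ≤ 1}`, `= 1/2` off it) has the package, GAP, the isosceles RP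
minors, the envelope, the single-pinch law, strict positivity AND far merging (on the collinear shape
with `c = 1/9`, on every thin shape `Th(a)·s`, `s ≥ 2`, with `c = 1`: `thinMerging_E`), and violates
quasi-multiplicativity even in the dyadic `2^{-o(ℓ)}`-defect form (`𝒜_E(e₂;m) = 2q_m²`,
`𝒜_E(se₂;m) = 1` for `2 ≤ s ≤ m`). So uniform quasi-multiplicativity FROM BELOW can fail in a world
WITH far merging — its failure mode "the pinch decays faster than the opened passage predicts" is what
STRONG merging looks like — and stub 4 is a sufficiency device strictly stronger than the crux
relative to the line: `quasiMultiplicative_not_forced_by_farMerging`. (Landing copy: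
`Negative/FarMergingWithoutQM.lean`, proposed.)
-/

/-! ## Family E: A′ on the nearest-neighbour stratum, B in the bulk -/

/-- `θ_E = θ_{A′}` if `sep ≤ 1`, `1/2` otherwise. [folklore] -/
def θE (y : Fin 4 → Site 3) : ℝ := if sep y ≤ 1 then θA' y else 1 / 2

/-- Family E. [folklore] -/
def FE : (Fin 4 → Site 3) → ℝ := Fθ θE

/-- `θ_E` is admissible. [folklore] -/
theorem thetaHyp_E : ThetaHyp θE where
  nonneg y := by
    unfold θE
    split_ifs
    · exact θA'_nonneg y
    · norm_num
  le_one y := by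
    unfold θE
    split_ifs
    · exact (θA'_le_θA y).trans (θA_le_one y)
    · norm_num
  swap01 y := by simp only [θE, sep_comp_perm, thetaHyp_A'.swap01]
  swap12 y := by simp only [θE, sep_comp_perm, thetaHyp_A'.swap12]
  swap23 y := by simp only [θE, sep_comp_perm, thetaHyp_A'.swap23]
  transl y v := by simp only [θE, sep_transl, thetaHyp_A'.transl]
  coincide a x z := by
    unfold θE
    rw [if_pos (by rw [sep_coincide]; norm_num)]
    exact thetaHyp_A'.coincide a x z

/-- Family E has the soft package. [folklore] -/
theorem softPackage_E : SoftPackage S₀ T₀ FE := softPackage_Fθ_core thetaHyp_E not_summable_S₀_sq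

/-- Family E has the package without the bubble field. [folklore] -/
theorem softPackageNoBubble_E : SoftPackageNoBubble S₀ T₀ FE :=
  ((softPackage_iff_noBubble_and_bubble _ _ _).1 softPackage_E).1

/-- `E = A′` on the nearest-neighbour stratum. [folklore] -/
theorem FE_eq_FA'_of_sep_le_one {y : Fin 4 → Site 3} (hy : sep y ≤ 1) : FE y = FA' y := by
  simp only [FE, FA', Fθ, θE, if_pos hy]

/-- `E = B` off the nearest-neighbour stratum. [folklore] -/
theorem FE_eq_FB_of_two_le_sep {y : Fin 4 → Site 3} (hy : 2 ≤ sep y) : FE y = FB y := by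
  have h1 : ¬ sep y ≤ 1 := by linarith
  have h2 : sep y ≠ 0 := by linarith
  simp only [FE, FB, Fθ, θE, θB, if_neg h1, if_neg h2]

/-- Off the nearest-neighbour stratum `U₄^E = -Pmin`. [folklore] -/
theorem FE_sub_wick_of_two_le_sep {y : Fin 4 → Site 3} (hy : 2 ≤ sep y) :
    FE y - (S₀ (y 0) (y 1) * S₀ (y 2) (y 3) + S₀ (y 0) (y 2) * S₀ (y 1) (y 3)
      + S₀ (y 0) (y 3) * S₀ (y 1) (y 2)) = -pmin S₀ y := by
  have h1 : ¬ sep y ≤ 1 := by linarith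
  rw [FE, Fθ_sub_wick, θE, if_neg h1]; ring

/-! ## Verdicts: every input of the line, and far merging -/

/-- **E satisfies the GAP shape** (it is A′ on the adjacent stratum). [folklore] -/
theorem gapShape_E : GapShape S₀ T₀ FE :=
  gapShape_of_le_add gapShape_A' 0 fun x _ => by
    rw [FE_eq_FA'_of_sep_le_one (sep_adjacent_le_one x)]; simp

/-- **E has far merging** (it is B on every dilation `L ≥ 2` of an injective shape). [folklore] -/
theorem farMergingShape_E : FarMergingShape S₀ FE := by
  obtain ⟨c, hc, x, hx, h⟩ := farMergingShape_B
  refine ⟨c, hc, x, hx, fun L₀ => ?_⟩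
  obtain ⟨L, hL, hineq⟩ := h (max L₀ 2)
  refine ⟨L, (le_max_left _ _).trans hL, ?_⟩
  have hL2 : (2 : ℝ) ≤ L := by exact_mod_cast (le_max_right _ _).trans hL
  rw [FE_eq_FB_of_two_le_sep (hL2.trans (le_sep_smul hx L))]
  exact hineq

section evals
variable {m s : ℕ} (hm : 1 ≤ m)
include hm

/-- `θ_E = 1/2` at the opened configuration `v = (0, s e₂, up m, dn m)`, `2 ≤ s ≤ m`. [folklore] -/
theorem θE_v (hs : 2 ≤ s) (hsm : s ≤ m) : θE ![0, src s, up m, dn m] = 1 / 2 := by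
  obtain ⟨-, -, -, -, hsep⟩ := evals_v hm (le_trans (by norm_num) hs) hsm
  have hs' : ¬ ((s : ℝ) ≤ 1) := by
    have : (2 : ℝ) ≤ s := by exact_mod_cast hs
    linarith
  unfold θE; rw [hsep, if_neg hs']

/-- `T_E(s e₂; m) = q²` for `2 ≤ s ≤ m`. [folklore] -/
theorem TS_v_E (hs : 2 ≤ s) (hsm : s ≤ m) :
    FE ![0, src s, up m, dn m] - S₀ 0 (src s) * S₀ (up m) (dn m) = q m * q m := by
  have hs1 : 1 ≤ s := le_trans (by norm_num) hs
  obtain ⟨h1, h2, h3, hp, -⟩ := evals_v hm hs1 hsm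
  have hP1 : S₀ 0 (src s) * S₀ (up m) (dn m) = P₁ S₀ ![0, src s, up m, dn m] := by simp [P₁]
  rw [hP1, FE, Fθ, wick, hp, θE_v hm hs hsm, h1, h2, h3]; ring

/-- **`𝒜_E(s e₂; m) = 1`** for `2 ≤ s ≤ m`: the opened passage costs nothing. [folklore] -/
theorem avoid_v_E (hs : 2 ≤ s) (hsm : s ≤ m) : avoidS S₀ FE (src s) m = 1 := by
  unfold avoidS TS NparS pairCovS
  rw [TS_v_E hm hs hsm, Npar_v hm (le_trans (by norm_num) hs) hsm]
  have := q_pos m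
  field_simp

/-- `T_E(e₂; m) = 2q⁴` (the pinched configuration lies on the nearest-neighbour stratum: A′). [folklore] -/
theorem TS_w_E : FE ![0, e₂, up m, dn m] - S₀ 0 e₂ * S₀ (up m) (dn m) = 2 * (q m * q m) ^ 2 := by
  rw [FE_eq_FA'_of_sep_le_one (by rw [(evals_w hm).2.2.2.2])]; exact TS_w hm

/-- **`𝒜_E(e₂; m) = 2q_m²`** (as for A′). [folklore] -/
theorem avoid_w_E : avoidS S₀ FE e₂ m = 2 * (q m * q m) := by
  unfold avoidS TS NparS pairCovS
  rw [TS_w_E hm, Npar_w hm]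
  have := q_pos m
  field_simp

/-- The GAP quantity of E at `2m e₁`: `2q⁴` (A′). [folklore] -/
theorem gapq_x_E : FE ![0, e₂, xR m, xR m + e₂] - S₀ 0 e₂ * S₀ (xR m) (xR m + e₂) = 2 * (q m * q m) ^ 2 := by
  rw [FE_eq_FA'_of_sep_le_one (by rw [(evals_x hm).2.2.2.2])]; exact gapq_x hm

/-- `θ_E = 1/2` at the mirror configuration `u = (m e₂, -m e₂, up m, dn m)`. [folklore] -/
theorem θE_u : θE ![Pi.single 1 (m : ℤ), Pi.single 1 (-(m : ℤ)), up m, dn m] = 1 / 2 := by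
  obtain ⟨-, -, -, -, hsep⟩ := evals_u hm
  have hm' : ¬ (2 * (m : ℝ) ≤ 1) := by have := one_le_m hm; linarith
  unfold θE; rw [hsep, if_neg hm']

/-- The un-pinched pair–pair factor of E: `q²`. [folklore] -/
theorem pairpair_u_E :
    FE ![Pi.single 1 (m : ℤ), Pi.single 1 (-(m : ℤ)), up m, dn m] -
        S₀ (Pi.single 1 (m : ℤ)) (Pi.single 1 (-(m : ℤ))) * S₀ (up m) (dn m) = q m * q m := by
  obtain ⟨h1, h2, h3, hp, -⟩ := evals_u hm
  have hP1 : S₀ (Pi.single 1 (m : ℤ)) (Pi.single 1 (-(m : ℤ))) * S₀ (up m) (dn m) =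
      P₁ S₀ ![Pi.single 1 (m : ℤ), Pi.single 1 (-(m : ℤ)), up m, dn m] := by simp [P₁]
  rw [hP1, FE, Fθ, wick, hp, θE_u hm, h1, h2, h3]; ring

end evals

section verdicts

/-- **E satisfies the single-pinch law** (`κ' = 2`, as A′). [folklore] -/
theorem singlePinchLawShape_E : SinglePinchLawShape S₀ T₀ FE := by
  obtain ⟨κ', C, hκ', h⟩ := singlePinchLawShape_A'
  refine ⟨κ', C, hκ', fun m hm => ?_⟩
  show FE ![0, e₂, up m, dn m] - S₀ 0 e₂ * S₀ (up m) (dn m) ≤ C * (2 * (m : ℝ)) ^ (-κ') * T₀ (xR m) ^ 2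
  rw [TS_w_E hm, ← TS_w hm]
  exact h m hm

/-- **E has a strictly positive single-pinch truncation.** [folklore] -/
theorem singlePinchPositiveShape_E : SinglePinchPositiveShape S₀ FE := fun m hm => by
  show 0 < FE ![0, e₂, up m, dn m] - S₀ 0 e₂ * S₀ (up m) (dn m)
  rw [TS_w_E hm]; have := q_pos m; positivity

/-- **E satisfies the un-pinched envelope** `0 ≤ q² ≤ 2q²`. [folklore] -/
theorem unpinchedEnvelopeShape_E : UnpinchedEnvelopeShape S₀ T₀ FE := fun m hm => by
  show 0 ≤ FE ![Pi.single 1 (m : ℤ), Pi.single 1 (-(m : ℤ)), up m, dn m] -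
      S₀ (Pi.single 1 (m : ℤ)) (Pi.single 1 (-(m : ℤ))) * S₀ (up m) (dn m) ∧
    FE ![Pi.single 1 (m : ℤ), Pi.single 1 (-(m : ℤ)), up m, dn m] -
      S₀ (Pi.single 1 (m : ℤ)) (Pi.single 1 (-(m : ℤ))) * S₀ (up m) (dn m) ≤ 2 * T₀ (xR m) ^ 2
  rw [pairpair_u_E hm, T₀_xR hm]
  have hq0 := q_pos m
  constructor
  · positivity
  · nlinarith [mul_pos hq0 hq0]

/-- **E satisfies the isosceles RP minors**: `(2q⁴)² ≤ 2q⁴ · q²`, i.e. `2q² ≤ 1`. [folklore] -/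
theorem rpUnpinchIsoShape_E : RPUnpinchIsoShape S₀ FE := fun m hm => by
  show (FE ![0, e₂, up m, dn m] - S₀ 0 e₂ * S₀ (up m) (dn m)) ^ 2 ≤
    (FE ![0, e₂, xR m, xR m + e₂] - S₀ 0 e₂ * S₀ (xR m) (xR m + e₂)) *
      (FE ![Pi.single 1 (m : ℤ), Pi.single 1 (-(m : ℤ)), up m, dn m] -
        S₀ (Pi.single 1 (m : ℤ)) (Pi.single 1 (-(m : ℤ))) * S₀ (up m) (dn m))
  rw [TS_w_E hm, gapq_x_E hm, pairpair_u_E hm]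
  set Q := q m * q m with hQ
  have hQ0 : 0 < Q := mul_pos (q_pos m) (q_pos m)
  have hQ4 : Q ≤ 1 / 4 := by have := q_le_half hm; have := q_pos m; rw [hQ]; nlinarith
  nlinarith [pow_pos hQ0 3, pow_pos hQ0 4]

/-- **E violates one-passage quasi-multiplicativity**: `𝒜_E(e₂;m) = 2q_m² → 0` while
`𝒜_E(e₂;2)·𝒜_E(2e₂;m) = 2/25`. [folklore] -/
theorem not_quasiMultiplicativeShape_E : ¬ QuasiMultiplicativeShape S₀ FE := by
  rintro ⟨c, hc, h⟩
  obtain ⟨n, hn⟩ := exists_nat_gt (25 / c)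
  have hn0 : (0 : ℝ) < n := lt_trans (by positivity) hn
  set m : ℕ := max n 4 with hm_def
  have hm4 : 4 ≤ m := le_max_right _ _
  have hm1 : 1 ≤ m := le_trans (by norm_num) hm4
  have hnm : (n : ℝ) ≤ m := by exact_mod_cast le_max_left n 4
  have key := h 2 m (by norm_num) (by omega)
  rw [avoid_w_E (by norm_num), avoid_w_E hm1, avoid_v_E hm1 le_rfl (by omega)] at key
  have hq2 : q 2 = 1 / 5 := by rw [q]; norm_num
  rw [hq2] at key
  have hq0 := q_pos m
  have hqm : q m < c / 25 := by
    have h1 : q m ≤ (n : ℝ)⁻¹ := by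
      rw [q]; exact inv_anti₀ hn0 (by linarith)
    have h2 : (n : ℝ)⁻¹ < c / 25 := by
      rw [div_lt_iff₀ hc] at hn
      rw [inv_lt_iff_one_lt_mul₀ hn0]
      linarith
    exact lt_of_le_of_lt h1 h2
  have hq1 : q m ≤ 1 := (q_le_half hm1).trans (by norm_num)
  -- key : c * (2 * (1/5 * (1/5))) * 1 ≤ 2 * (q m * q m)
  nlinarith [mul_pos hc hq0]

/-- **E violates even DYADIC quasi-multiplicativity with sub-exponential defect**: along
`(2^i, 2^{i+ℓ})` the required constant is `c(ℓ) ≤ (q_{2^{i+ℓ}}/q_{2^i})² < 4^{-ℓ}`, below `(3/4)^ℓ`. [folklore] -/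
theorem not_quasiMultiplicativeDyadicShape_E : ¬ QuasiMultiplicativeDyadicShape S₀ FE := by
  intro h
  obtain ⟨ℓ₀, hℓ₀⟩ := h (3 / 4) (by norm_num) (by norm_num)
  set ℓ : ℕ := max ℓ₀ 1 with hℓ_def
  have hℓ1 : 1 ≤ ℓ := le_max_right _ _
  obtain ⟨c, hc, i₁, hi⟩ := hℓ₀ ℓ (le_max_left _ _)
  set i : ℕ := max i₁ 1 with hi_def
  have key := hi i (le_max_left _ _)
  -- the scales s = 2^i ≥ 2 and m = 2^(i+ℓ) = 2^ℓ s ≥ 2 s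
  have hs2 : 2 ≤ 2 ^ i :=
    calc 2 = 2 ^ 1 := (pow_one 2).symm
      _ ≤ 2 ^ i := Nat.pow_le_pow_right (by norm_num) (le_max_right _ _)
  have hM2 : 2 ≤ 2 ^ ℓ :=
    calc 2 = 2 ^ 1 := (pow_one 2).symm
      _ ≤ 2 ^ ℓ := Nat.pow_le_pow_right (by norm_num) hℓ1
  have hsm : 2 ^ i ≤ 2 ^ (i + ℓ) := Nat.pow_le_pow_right (by norm_num) (by omega)
  have hm1 : 1 ≤ 2 ^ (i + ℓ) := Nat.one_le_two_pow
  have hs1 : 1 ≤ 2 ^ i := Nat.one_le_two_pow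
  rw [avoid_w_E hs1, avoid_w_E hm1, avoid_v_E hm1 hs2 hsm, mul_one] at key
  -- key : c * (2 * (q (2^i) * q (2^i))) ≤ 2 * (q (2^(i+ℓ)) * q (2^(i+ℓ)))
  set S : ℝ := ((2 ^ i : ℕ) : ℝ) with hS
  set M : ℝ := ((2 ^ ℓ : ℕ) : ℝ) with hM
  have hS2 : (2 : ℝ) ≤ S := by rw [hS]; exact_mod_cast hs2
  have hM2' : (2 : ℝ) ≤ M := by rw [hM]; exact_mod_cast hM2
  have hqs : q (2 ^ i) = (1 + 2 * S)⁻¹ := by rw [q]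
  have hqm : q (2 ^ (i + ℓ)) = (1 + 2 * (M * S))⁻¹ := by
    rw [q, hM, hS]; push_cast; rw [pow_add]; ring
  rw [hqs, hqm] at key
  -- (3/4)^ℓ ≤ c and 4^ℓ = M², 3^ℓ ≥ 3
  have h34 : (3 / 4 : ℝ) ^ ℓ * M ^ 2 = (3 : ℝ) ^ ℓ := by
    rw [hM]; push_cast
    rw [div_pow, ← pow_mul, show (4 : ℝ) = 2 ^ 2 by norm_num, ← pow_mul, mul_comm 2 ℓ]
    field_simp
  have h3 : (3 : ℝ) ≤ (3 : ℝ) ^ ℓ := by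
    calc (3 : ℝ) = 3 ^ 1 := (pow_one _).symm
      _ ≤ 3 ^ ℓ := pow_le_pow_right₀ (by norm_num) hℓ1
  have hcM : 3 ≤ c * M ^ 2 := by
    have := mul_le_mul_of_nonneg_right hc (sq_nonneg M)
    linarith
  -- from key: c (1 + 2 M S)² ≤ (1 + 2 S)²
  have hpos1 : 0 < 1 + 2 * S := by linarith
  have hpos2 : 0 < 1 + 2 * (M * S) := by nlinarith
  have key' : c * (1 + 2 * (M * S)) ^ 2 ≤ (1 + 2 * S) ^ 2 := by
    have e1 : (1 + 2 * S)⁻¹ * (1 + 2 * S)⁻¹ = ((1 + 2 * S) ^ 2)⁻¹ := by rw [sq, mul_inv]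
    have e2 : (1 + 2 * (M * S))⁻¹ * (1 + 2 * (M * S))⁻¹ = ((1 + 2 * (M * S)) ^ 2)⁻¹ := by
      rw [sq, mul_inv]
    rw [e1, e2] at key
    have hA : 0 < (1 + 2 * S) ^ 2 := by positivity
    have hB : 0 < (1 + 2 * (M * S)) ^ 2 := by positivity
    have k2 : c * ((1 + 2 * S) ^ 2)⁻¹ ≤ ((1 + 2 * (M * S)) ^ 2)⁻¹ := by linarith
    rw [← div_eq_mul_inv, div_le_iff₀ hA, ← div_eq_inv_mul] at k2
    rwa [le_div_iff₀ hB] at k2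
  -- c M² (2S)² ≤ c (1 + 2MS)² ≤ (1+2S)², with c M² ≥ 3 and S ≥ 2: contradiction
  have hc0 : 0 ≤ c := le_trans (by positivity) hc
  have h4 : c * (M ^ 2 * (2 * S) ^ 2) ≤ c * (1 + 2 * (M * S)) ^ 2 := by
    apply mul_le_mul_of_nonneg_left _ hc0
    nlinarith
  nlinarith

/-- **Far merging on every thin shape, at every scale**: for `2 ≤ s ≤ m`,
`U₄^E(0, dn m, s e₂, up m) = -⟨σ₀σ_{dn m}⟩⟨σ_{se₂}σ_{up m}⟩` (Aizenman's bound saturated in the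
parallel pairing: the opened strands of E merge with probability `1/2`… in the dictionary, `c = 1`). [folklore] -/
theorem thinMerging_E {s m : ℕ} (hm : 1 ≤ m) (hs : 2 ≤ s) (hsm : s ≤ m) :
    FE ![0, dn m, src s, up m] - (S₀ 0 (dn m) * S₀ (src s) (up m) + S₀ 0 (src s) * S₀ (dn m) (up m) +
        S₀ 0 (up m) * S₀ (dn m) (src s)) = -(S₀ 0 (dn m) * S₀ (src s) (up m)) := by
  have hs1 : 1 ≤ s := le_trans (by norm_num) hs
  obtain ⟨h1, h2, h3, hp, hsep⟩ := evals_v hm hs1 hsm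
  have hperm : FE ![0, dn m, src s, up m] = FE ![0, src s, up m, dn m] :=
    (F_perm_dsu softPackageNoBubble_E (dn m) (src s) (up m)).symm
  have hP3 : S₀ 0 (dn m) * S₀ (src s) (up m) = P₃ S₀ ![0, src s, up m, dn m] := by simp [P₃]
  have hP1 : S₀ 0 (src s) * S₀ (dn m) (up m) = P₁ S₀ ![0, src s, up m, dn m] := by
    simp [P₁, S₀_symm (dn m) (up m)]
  have hP2 : S₀ 0 (up m) * S₀ (dn m) (src s) = P₂ S₀ ![0, src s, up m, dn m] := by
    simp [P₂, S₀_symm (dn m) (src s)]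
  rw [hperm, hP3, hP1, hP2, FE, Fθ, wick, hp, θE_v hm hs hsm, h1, h2, h3]; ring

/-- The witness, packaged: ALL soft inputs of the line AND far merging, without quasi-multiplicativity
(uniform or dyadic). [folklore] -/
theorem lineInputs_with_farMerging_without_QM :
    ∃ (S : Site 3 → Site 3 → ℝ) (T : Site 3 → ℝ) (F : (Fin 4 → Site 3) → ℝ),
      SoftPackage S T F ∧ GapShape S T F ∧ RPUnpinchIsoShape S F ∧ UnpinchedEnvelopeShape S T F ∧
        SinglePinchLawShape S T F ∧ SinglePinchPositiveShape S F ∧ FarMergingShape S F ∧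
        ¬ QuasiMultiplicativeShape S F ∧ ¬ QuasiMultiplicativeDyadicShape S F :=
  ⟨S₀, T₀, FE, softPackage_E, gapShape_E, rpUnpinchIsoShape_E, unpinchedEnvelopeShape_E,
    singlePinchLawShape_E, singlePinchPositiveShape_E, farMergingShape_E, not_quasiMultiplicativeShape_E,
    not_quasiMultiplicativeDyadicShape_E⟩

/-- **Quasi-multiplicativity is not forced by far merging** (stub 4 is not necessary, even softly and
even in its dyadic form): no argument from the soft package + GAP + isosceles RP + envelope +
single-pinch law + strict positivity + FAR MERGING proves dyadic quasi-multiplicativity. [folklore] -/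
theorem quasiMultiplicative_not_forced_by_farMerging :
    ¬ ∀ (S : Site 3 → Site 3 → ℝ) (T : Site 3 → ℝ) (F : (Fin 4 → Site 3) → ℝ),
      SoftPackage S T F → GapShape S T F → RPUnpinchIsoShape S F → UnpinchedEnvelopeShape S T F →
        SinglePinchLawShape S T F → SinglePinchPositiveShape S F → FarMergingShape S F →
          QuasiMultiplicativeDyadicShape S F :=
  fun h => not_quasiMultiplicativeDyadicShape_E (h S₀ T₀ FE softPackage_E gapShape_E rpUnpinchIsoShape_E
    unpinchedEnvelopeShape_E singlePinchLawShape_E singlePinchPositiveShape_E farMergingShape_E)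

end verdicts


/-! # §10 (generation 4) Pinched transparency — the EXACT consumption of the iteration, a weaker stub 4′

Reading `scaleIteration_soft_dyadic` line by line: quasi-multiplicativity is invoked ONLY inside the
`¬FarMerging` branch, at pairs `(2^i, 2^{i+ℓ})` where the opened configuration
`Th(2^ℓ)·2^i = (0, dn 2^{i+ℓ}, 2^i e₂, up 2^{i+ℓ})` does NOT merge (`U₄ > -½⟨σσ⟩⟨σσ⟩`), and the opened
factor `𝒜(2^i e₂;2^{i+ℓ}) > 1/2` is then discarded. The consumed statement is
`PinchedTransparencyShape` ("transparent octaves are free for the pinched pair"): for every rate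
`η < 1` and all long passages `ℓ`, some `c(ℓ) ≥ η^ℓ` with, for all large `i`,
NON-MERGING at `(2^i,2^{i+ℓ})` ⟹ `c(ℓ)·𝒜(e₂;2^i) ≤ 𝒜(e₂;2^{i+ℓ})`.
* `transparency_of_qmDyadic` / `transparency_of_qm`: PT is WEAKER than both registered forms;
* `scaleIteration_soft_transparent`: SPL → SPP → PT → FarMerging over the package;
  `gapForcesFarMerging_of_transparency_stubs`: crux ⇐ stubs 1(iso), 2, 3 + PT (in the tree with the
  landed stubs discharged: `Negative.TransparentPassage.gapForcesFarMerging_of_transparency`, proposed;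
  the tree-vocabulary text of stub 4′ is `pinchedTransparencyShape_criticalCorr_iff`);
* `not_pinchedTransparency_A'`, `pinchedTransparency_false_without_model`: PT is NOT SOFT (A′) — the
  model still enters, but only in the counterfactual transparent regime;
* `SlowPinchUnderTransparencyShape` (ST, stub 4″ — the residual in sequence form, no blocks, no
  positivity): transparency of the far field on the thin dyadic shapes ⟹ `𝒜(e₂;2^i) ≥ c(η)η^i` for
  every `η < 1`; `slowPinch_of_transparency : SPP → PT → ST`, `farMerging_of_slowPinch : SPL → ST → FM`,
  `gapForcesFarMerging_of_slowPinch : ST cc2 (criticalCorr 3 4) → GapForcesFarMerging`,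
  `slowPinch_false_without_model`; `stub4_taxonomy` packages the chain QM ⟹ QMD ⟹ PT ⟹ ST;
* `slowPinch_iff_thinFarMerging : SPL → (ST ↔ ThinFarMergingShape)` and
  `pinchedTransparency_of_eventualMerging : EventualMergingShape → PT`: the taxonomy BOTTOMS OUT —
  ST is the residual crux `SPL ⟹ FM_thin` in contrapositive sequence form and nothing more, and PT is
  vacuous in any world with the expected eventual merging at large aspect ratios; the content of both
  is the counterfactual transparent branch ONLY. (QM's truth in the interacting regime would in
  addition encode the exponent identity `κ_s ≍ s^{ζ}` of the lattice three-point coefficients —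
  strictly harder than the crux, and unnecessary by family E.)
* `pinchedTransparency_E`: family E of §9 PASSES PT (vacuously — it merges on every thin shape) while
  failing QM/QMD: `lineInputs_with_farMerging_and_transparency_without_QM`. So PT separates from
  stub 4 exactly on the converse side and is the better-posed target: its content is
  separation + source-Harnack for ONE passage ONLY IN OCTAVE BLOCKS WHERE FAR STRANDS DO NOT MERGE
  (in the merging blocks nothing is asked — there the crux's conclusion already holds).
Heuristic for the lead: in the transparent regime the opened clusters are thin at the large scales,
and "the pinched pair conditioned on avoidance up to 2^i continues like fresh sources at separation
2^i" is needed only against a background in which fresh sources pass freely; the small-scale half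
(separation at the pinch) is untouched by the conditioning and remains the hard part.
-/

section shapes

variable {S : Site 3 → Site 3 → ℝ} {T : Site 3 → ℝ} {F : (Fin 4 → Site 3) → ℝ}

/-- The avoidance functional is non-negative (GKS II). [folklore] -/
theorem avoidS_nonneg_soft (hP : SoftPackageNoBubble S T F) (b : Site 3) (m : ℕ) :
    0 ≤ avoidS S F b m := by
  unfold avoidS TS pairCovS
  refine div_nonneg ?_ (NparS_pos hP b m).le
  have h := hP.griffiths ![0, b, up m, dn m]
  simp only [Matrix.cons_val_zero, Matrix.cons_val_one, Matrix.cons_val] at h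
  linarith

/-- **Pinched transparency** (stub 4′, the exact consumption of the scale iteration): for every rate
`η ∈ (0,1)` and all large passage lengths `ℓ` there are `c(ℓ) ≥ η^ℓ` and `i₁` such that for `i ≥ i₁`:
IF the opened configuration `(0, dn 2^{i+ℓ}, 2^i e₂, up 2^{i+ℓ})` does not merge in Aizenman's sense
(`U₄ > -½·S(0,dn)S(2^i e₂,up)`), THEN `c(ℓ)·𝒜(e₂;2^i) ≤ 𝒜(e₂;2^{i+ℓ})`. [folklore] -/
def PinchedTransparencyShape (S : Site 3 → Site 3 → ℝ) (F : (Fin 4 → Site 3) → ℝ) : Prop :=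
  ∀ η : ℝ, 0 < η → η < 1 → ∃ ℓ₀ : ℕ, ∀ ℓ : ℕ, ℓ₀ ≤ ℓ → ∃ c : ℝ, η ^ ℓ ≤ c ∧ ∃ i₁ : ℕ, ∀ i : ℕ, i₁ ≤ i →
    -(1 / 2 * (S 0 (dn (2 ^ (i + ℓ))) * S (src (2 ^ i)) (up (2 ^ (i + ℓ))))) <
        F ![0, dn (2 ^ (i + ℓ)), src (2 ^ i), up (2 ^ (i + ℓ))] -
          (S 0 (dn (2 ^ (i + ℓ))) * S (src (2 ^ i)) (up (2 ^ (i + ℓ))) +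
            S 0 (src (2 ^ i)) * S (dn (2 ^ (i + ℓ))) (up (2 ^ (i + ℓ))) +
            S 0 (up (2 ^ (i + ℓ))) * S (dn (2 ^ (i + ℓ))) (src (2 ^ i))) →
      c * avoidS S F e₂ (2 ^ i) ≤ avoidS S F e₂ (2 ^ (i + ℓ))

/-- **Dyadic quasi-multiplicativity implies pinched transparency** (over the package: in a
non-merging octave block the discarded factor is `𝒜(2^i e₂; 2^{i+ℓ}) > 1/2`,
`half_lt_avoidS_of_not_merge`; the factor `1/2` is absorbed by raising the rate). [folklore] -/
theorem transparency_of_qmDyadic (hP : SoftPackageNoBubble S T F)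
    (h : QuasiMultiplicativeDyadicShape S F) : PinchedTransparencyShape S F := by
  intro η hη0 hη1
  -- raise the rate: η' = (1+η)/2, and 2 η^ℓ ≤ η'^ℓ for large ℓ
  set η' : ℝ := (1 + η) / 2 with hη'
  have hη'0 : 0 < η' := by rw [hη']; linarith
  have hη'1 : η' < 1 := by rw [hη']; linarith
  have hηη' : η < η' := by rw [hη']; linarith
  have hq0 : 0 < η / η' := div_pos hη0 hη'0
  have hq1 : η / η' < 1 := (div_lt_one hη'0).2 hηη'
  obtain ⟨ℓ₂, hℓ₂⟩ := exists_pow_lt_of_lt_one (show (0 : ℝ) < 1 / 2 by norm_num) hq1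
  obtain ⟨ℓ₀, hℓ₀⟩ := h η' hη'0 hη'1
  refine ⟨max ℓ₀ ℓ₂, fun ℓ hℓ => ?_⟩
  obtain ⟨c, hc, i₁, hqm⟩ := hℓ₀ ℓ ((le_max_left _ _).trans hℓ)
  have hcpos : 0 < c := lt_of_lt_of_le (pow_pos hη'0 ℓ) hc
  refine ⟨c / 2, ?_, i₁, fun i hi hL => ?_⟩
  · -- η^ℓ = (η/η')^ℓ η'^ℓ ≤ (1/2) η'^ℓ ≤ c/2
    have h1 : (η / η') ^ ℓ ≤ 1 / 2 :=
      ((pow_le_pow_of_le_one hq0.le hq1.le ((le_max_right _ _).trans hℓ)).trans hℓ₂.le)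
    have h2 : η ^ ℓ = (η / η') ^ ℓ * η' ^ ℓ := by
      rw [← mul_pow, div_mul_cancel₀ η hη'0.ne']
    rw [h2]
    have h3 : 0 ≤ η' ^ ℓ := (pow_pos hη'0 ℓ).le
    nlinarith [mul_le_mul_of_nonneg_right h1 h3]
  · have hav := half_lt_avoidS_of_not_merge hP hL
    have hq := hqm i hi
    have hA0 : 0 ≤ avoidS S F e₂ (2 ^ i) := avoidS_nonneg_soft hP _ _
    have : c / 2 * avoidS S F e₂ (2 ^ i) ≤
        c * avoidS S F e₂ (2 ^ i) * avoidS S F (src (2 ^ i)) (2 ^ (i + ℓ)) := by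
      have := mul_nonneg hcpos.le hA0
      nlinarith
    exact this.trans hq

/-- Uniform quasi-multiplicativity implies pinched transparency. [folklore] -/
theorem transparency_of_qm (hP : SoftPackageNoBubble S T F) (h : QuasiMultiplicativeShape S F) :
    PinchedTransparencyShape S F :=
  transparency_of_qmDyadic hP (qmDyadic_of_qm h)

/-- **Stub 5 runs on pinched transparency alone.** Over any triple with the soft package:
single-pinch law + strict single-pinch positivity + pinched transparency ⟹ far merging (along a thin
shape `Th(2^ℓ)`, by contradiction with `c = 1/2`; the proof is the dyadic iteration with the
quasi-multiplicativity call replaced by the conditional one — its hypothesis is exactly the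
non-merging statement available in the `¬ FarMerging` branch). [folklore] -/
theorem scaleIteration_soft_transparent (hP : SoftPackageNoBubble S T F) :
    SinglePinchLawShape S T F → SinglePinchPositiveShape S F → PinchedTransparencyShape S F →
      FarMergingShape S F := by
  rintro ⟨κ', C, hκ', hspl⟩ hSPP hPT
  by_contra hFM
  -- the avoidance sequence along dyadic scales and its positivity
  set A : ℕ → ℝ := fun i => avoidS S F e₂ (2 ^ i) with hA
  have hApos : ∀ i, 0 < A i := fun i =>
    div_pos (hSPP (2 ^ i) Nat.one_le_two_pow) (NparS_pos hP _ _)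
  -- r = 2^{-κ'} ∈ (0,1), η = √r; choose ℓ ≥ 1 with η^ℓ ≤ 1/2 and a constant c ≥ η^ℓ along (2^i, 2^{i+ℓ})
  set r : ℝ := (2 : ℝ) ^ (-κ') with hr
  have hr0 : 0 < r := Real.rpow_pos_of_pos two_pos _
  have hr1 : r < 1 := Real.rpow_lt_one_of_one_lt_of_neg one_lt_two (by linarith)
  set η : ℝ := Real.sqrt r with hη
  have hη0 : 0 < η := Real.sqrt_pos.2 hr0
  have hη1 : η < 1 := by rw [hη, ← Real.sqrt_one]; exact Real.sqrt_lt_sqrt hr0.le hr1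
  have hηr : η ^ 2 = r := Real.sq_sqrt hr0.le
  obtain ⟨ℓ₀, hℓ₀⟩ := hPT η hη0 hη1
  obtain ⟨ℓ₁, hℓ₁⟩ := exists_pow_lt_of_lt_one (show (0 : ℝ) < 1 / 2 by norm_num) hη1
  obtain ⟨ℓ, hℓ1, hℓℓ₀, hℓℓ₁⟩ : ∃ ℓ : ℕ, 1 ≤ ℓ ∧ ℓ₀ ≤ ℓ ∧ ℓ₁ ≤ ℓ :=
    ⟨max (max ℓ₀ ℓ₁) 1, le_max_right _ _, (le_max_left _ _).trans (le_max_left _ _),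
      (le_max_right _ _).trans (le_max_left _ _)⟩
  obtain ⟨c, hcη, i₁, hpt⟩ := hℓ₀ ℓ hℓℓ₀
  have hηℓ : 0 < η ^ ℓ := pow_pos hη0 ℓ
  have hc : 0 < c := lt_of_lt_of_le hηℓ hcη
  have hrℓ : r ^ ℓ ≤ c / 2 := by
    have h1 : η ^ ℓ ≤ 1 / 2 := (pow_le_pow_of_le_one hη0.le hη1.le hℓℓ₁).trans hℓ₁.le
    calc r ^ ℓ = η ^ ℓ * η ^ ℓ := by rw [← hηr, ← pow_mul, mul_comm 2 ℓ, pow_mul, sq]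
      _ ≤ (1 / 2) * c := mul_le_mul h1 hcη hηℓ.le (by norm_num)
      _ = c / 2 := by ring
  -- no far merging along the thin shape Th(2^ℓ) with c = 1/2
  have hFM' := hFM
  unfold FarMergingShape at hFM'
  push Not at hFM'
  obtain ⟨L₀, hL₀⟩ := hFM' (1 / 2) (by norm_num) (Th (2 ^ ℓ)) (Th_injective Nat.one_le_two_pow)
  set I₀ : ℕ := max L₀ i₁ with hI₀
  -- one step of the iteration: the conditional call, fed with the non-merging of the branch
  have step : ∀ i, I₀ ≤ i → c * A i ≤ A (i + ℓ) := by
    intro i hi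
    have hiL : L₀ ≤ i := (le_max_left _ _).trans hi
    have hi₁ : i₁ ≤ i := (le_max_right _ _).trans hi
    have hL := hL₀ (2 ^ i) (hiL.trans Nat.lt_two_pow_self.le)
    obtain ⟨h0, h1, h2, h3⟩ := smul_Th_pts (2 ^ ℓ) (2 ^ i)
    rw [smul_Th, h0, h1, h2, h3] at hL
    rw [show 2 ^ ℓ * 2 ^ i = 2 ^ (i + ℓ) by rw [← pow_add, add_comm]] at hL
    exact hpt i hi₁ hL
  -- the iteration
  have iter : ∀ i, I₀ ≤ i → ∀ k : ℕ, c ^ k * A i ≤ A (i + k * ℓ) := by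
    intro i hi k
    induction k with
    | zero => simp
    | succ k ih =>
      have hs := step (i + k * ℓ) (by omega)
      rw [show i + (k + 1) * ℓ = i + k * ℓ + ℓ by ring]
      calc c ^ (k + 1) * A i = c * (c ^ k * A i) := by ring
        _ ≤ c * A (i + k * ℓ) := mul_le_mul_of_nonneg_left ih hc.le
        _ ≤ A (i + k * ℓ + ℓ) := hs
  -- a uniform positive floor over the ℓ starting scales
  obtain ⟨j₀, hj₀, hmin⟩ := Finset.exists_min_image (Finset.range ℓ) (fun j => A (I₀ + j))
    ⟨0, Finset.mem_range.2 (by omega)⟩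
  set a₀ := A (I₀ + j₀) with ha₀
  have ha₀pos : 0 < a₀ := hApos _
  have lower : ∀ i, I₀ ≤ i → c ^ ((i - I₀) / ℓ) * a₀ ≤ A i := by
    intro i hi
    have hdecomp : i = I₀ + (i - I₀) % ℓ + (i - I₀) / ℓ * ℓ := by
      have := Nat.mod_add_div (i - I₀) ℓ
      rw [mul_comm] ; omega
    have hjlt : (i - I₀) % ℓ < ℓ := Nat.mod_lt _ (by omega)
    have h1 := iter (I₀ + (i - I₀) % ℓ) (by omega) ((i - I₀) / ℓ)
    rw [← hdecomp] at h1
    have h2 : a₀ ≤ A (I₀ + (i - I₀) % ℓ) := hmin _ (Finset.mem_range.2 hjlt)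
    calc c ^ ((i - I₀) / ℓ) * a₀ ≤ c ^ ((i - I₀) / ℓ) * A (I₀ + (i - I₀) % ℓ) :=
          mul_le_mul_of_nonneg_left h2 (by positivity)
      _ ≤ A i := h1
  -- choose the depth k₀ and a good scale beyond it
  set Cp : ℝ := max C 0 with hCp
  have hCp0 : 0 ≤ Cp := le_max_right _ _
  obtain ⟨k₀, hk₀⟩ := exists_pow_lt_of_lt_one (show 0 < a₀ / (1024 * Cp + 1) by positivity)
    (show (1 / 2 : ℝ) < 1 by norm_num)
  obtain ⟨i, hiN, hgood⟩ := exists_good_scale hP (I₀ + k₀ * ℓ)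
  have hiL : I₀ ≤ i := by omega
  set k : ℕ := (i - I₀) / ℓ with hk
  have hk₀k : k₀ ≤ k := (Nat.le_div_iff_mul_le (by omega)).2 (by omega)
  have hkℓ : k * ℓ ≤ i + 1 := (Nat.div_mul_le_self (i - I₀) ℓ).trans (by omega)
  -- upper bound at the good scale
  have hup : A i ≤ 1024 * Cp * r ^ (i + 1) := by
    have h := avoidS_dyadic_le hP hspl i
    have hb3 : 0 < S 0 (Pi.single 0 ((2 ^ (i + 3) : ℕ) : ℤ)) := hP.pos _ _
    have hb1 : 0 ≤ S 0 (Pi.single 0 ((2 ^ (i + 1) : ℕ) : ℤ)) := (hP.pos _ _).le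
    have hratio : S 0 (Pi.single 0 ((2 ^ (i + 1) : ℕ) : ℤ)) ^ 2 /
        S 0 (Pi.single 0 ((2 ^ (i + 3) : ℕ) : ℤ)) ^ 2 ≤ 1024 := by
      rw [div_le_iff₀ (by positivity)]
      nlinarith [mul_le_mul hgood hgood hb1 (by positivity)]
    calc A i ≤ Cp * r ^ (i + 1) * S 0 (Pi.single 0 ((2 ^ (i + 1) : ℕ) : ℤ)) ^ 2 /
          S 0 (Pi.single 0 ((2 ^ (i + 3) : ℕ) : ℤ)) ^ 2 := h
      _ = Cp * r ^ (i + 1) * (S 0 (Pi.single 0 ((2 ^ (i + 1) : ℕ) : ℤ)) ^ 2 /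
          S 0 (Pi.single 0 ((2 ^ (i + 3) : ℕ) : ℤ)) ^ 2) := by ring
      _ ≤ Cp * r ^ (i + 1) * 1024 := mul_le_mul_of_nonneg_left hratio (by positivity)
      _ = 1024 * Cp * r ^ (i + 1) := by ring
  -- r^{i+1} ≤ (r^ℓ)^k ≤ (c/2)^k = c^k (1/2)^k
  have hrk : r ^ (i + 1) ≤ c ^ k * (1 / 2) ^ k := by
    calc r ^ (i + 1) ≤ r ^ (k * ℓ) := pow_le_pow_of_le_one hr0.le hr1.le hkℓ
      _ = (r ^ ℓ) ^ k := by rw [mul_comm, pow_mul]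
      _ ≤ (c / 2) ^ k := pow_le_pow_left₀ (by positivity) hrℓ k
      _ = c ^ k * (1 / 2) ^ k := by rw [← mul_pow]; ring
  -- combine
  have hck : 0 < c ^ k := by positivity
  have hmain : c ^ k * a₀ ≤ c ^ k * (1024 * Cp * (1 / 2) ^ k) := by
    calc c ^ k * a₀ ≤ A i := lower i hiL
      _ ≤ 1024 * Cp * r ^ (i + 1) := hup
      _ ≤ 1024 * Cp * (c ^ k * (1 / 2) ^ k) := mul_le_mul_of_nonneg_left hrk (by positivity)
      _ = c ^ k * (1024 * Cp * (1 / 2) ^ k) := by ring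
  have h1 : a₀ ≤ 1024 * Cp * (1 / 2) ^ k := le_of_mul_le_mul_left hmain hck
  have h2 : (1 / 2 : ℝ) ^ k ≤ (1 / 2) ^ k₀ := pow_le_pow_of_le_one (by norm_num) (by norm_num) hk₀k
  have h3 : (1 / 2 : ℝ) ^ k₀ * (1024 * Cp + 1) < a₀ := by
    rwa [lt_div_iff₀ (by positivity)] at hk₀
  nlinarith [mul_le_mul_of_nonneg_left h2 (by positivity : (0 : ℝ) ≤ 1024 * Cp),
    pow_pos (show (0 : ℝ) < 1 / 2 by norm_num) k₀]

/-- The registered stub 5 factors through pinched transparency. [folklore] -/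
theorem scaleIteration_soft_dyadic' (hP : SoftPackageNoBubble S T F) :
    SinglePinchLawShape S T F → SinglePinchPositiveShape S F → QuasiMultiplicativeDyadicShape S F →
      FarMergingShape S F :=
  fun h1 h2 h3 => scaleIteration_soft_transparent hP h1 h2 (transparency_of_qmDyadic hP h3)


/-- **Far merging on a thin dyadic shape** (the conclusion of the crux in the form the line produces
and consumes): for some aspect ratio `2^ℓ` and some `δ > 0`, infinitely often in `i` the opened
configuration `Th(2^ℓ)·2^i` merges, `U₄ ≤ -δ·S(0,dn)S(2^i e₂,up)`. [folklore] -/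
def ThinFarMergingShape (S : Site 3 → Site 3 → ℝ) (F : (Fin 4 → Site 3) → ℝ) : Prop :=
  ∃ ℓ : ℕ, 1 ≤ ℓ ∧ ∃ δ : ℝ, 0 < δ ∧ ∀ i₁ : ℕ, ∃ i : ℕ, i₁ ≤ i ∧
    F ![0, dn (2 ^ (i + ℓ)), src (2 ^ i), up (2 ^ (i + ℓ))] -
        (S 0 (dn (2 ^ (i + ℓ))) * S (src (2 ^ i)) (up (2 ^ (i + ℓ))) +
          S 0 (src (2 ^ i)) * S (dn (2 ^ (i + ℓ))) (up (2 ^ (i + ℓ))) +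
          S 0 (up (2 ^ (i + ℓ))) * S (dn (2 ^ (i + ℓ))) (src (2 ^ i))) ≤
      -(δ * (S 0 (dn (2 ^ (i + ℓ))) * S (src (2 ^ i)) (up (2 ^ (i + ℓ)))))

/-- **Eventual merging at every large aspect ratio** (the expected truth for an interacting critical
point: over `ℓ → ∞` octaves the opened strands meet almost surely): for all large `ℓ`, eventually in
`i`, `U₄(Th(2^ℓ)·2^i) ≤ -½·S(0,dn)S(2^i e₂,up)`. [folklore] -/
def EventualMergingShape (S : Site 3 → Site 3 → ℝ) (F : (Fin 4 → Site 3) → ℝ) : Prop :=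
  ∃ ℓ₀ : ℕ, ∀ ℓ : ℕ, ℓ₀ ≤ ℓ → ∃ i₁ : ℕ, ∀ i : ℕ, i₁ ≤ i →
    F ![0, dn (2 ^ (i + ℓ)), src (2 ^ i), up (2 ^ (i + ℓ))] -
        (S 0 (dn (2 ^ (i + ℓ))) * S (src (2 ^ i)) (up (2 ^ (i + ℓ))) +
          S 0 (src (2 ^ i)) * S (dn (2 ^ (i + ℓ))) (up (2 ^ (i + ℓ))) +
          S 0 (up (2 ^ (i + ℓ))) * S (dn (2 ^ (i + ℓ))) (src (2 ^ i))) ≤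
      -(1 / 2 * (S 0 (dn (2 ^ (i + ℓ))) * S (src (2 ^ i)) (up (2 ^ (i + ℓ)))))

/-- Thin far merging is far merging (shape `Th(2^ℓ)`, scales `L = 2^i`). [folklore] -/
theorem farMerging_of_thinFarMerging (h : ThinFarMergingShape S F) : FarMergingShape S F := by
  obtain ⟨ℓ, _, δ, hδ, hio⟩ := h
  refine ⟨δ, hδ, Th (2 ^ ℓ), Th_injective Nat.one_le_two_pow, fun L₀ => ?_⟩
  obtain ⟨i, hi, hmerge⟩ := hio L₀
  refine ⟨2 ^ i, hi.trans Nat.lt_two_pow_self.le, ?_⟩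
  obtain ⟨h0, h1, h2, h3⟩ := smul_Th_pts (2 ^ ℓ) (2 ^ i)
  rw [smul_Th, h0, h1, h2, h3, show 2 ^ ℓ * 2 ^ i = 2 ^ (i + ℓ) by rw [← pow_add, add_comm]]
  exact hmerge

/-- Eventual merging at large aspect ratios is thin far merging. [folklore] -/
theorem thinFarMerging_of_eventualMerging (h : EventualMergingShape S F) : ThinFarMergingShape S F := by
  obtain ⟨ℓ₀, hℓ₀⟩ := h
  obtain ⟨i₁, hi₁⟩ := hℓ₀ (max ℓ₀ 1) (le_max_left _ _)
  exact ⟨max ℓ₀ 1, le_max_right _ _, 1 / 2, by norm_num, fun j =>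
    ⟨max i₁ j, le_max_right _ _, hi₁ _ (le_max_left _ _)⟩⟩

/-- **Eventual merging makes pinched transparency vacuous**: if for all large `ℓ` the opened strands
merge eventually in `i`, the conditional step is never invoked. So in a world with the expected
interacting behaviour `PinchedTransparencyShape` holds for free; its content lies entirely in the
counterfactual transparent alternative. [folklore] -/
theorem pinchedTransparency_of_eventualMerging (h : EventualMergingShape S F) :
    PinchedTransparencyShape S F := by
  obtain ⟨ℓ₀, hℓ₀⟩ := h
  intro η hη0 hη1
  refine ⟨ℓ₀, fun ℓ hℓ => ?_⟩
  obtain ⟨i₁, hi₁⟩ := hℓ₀ ℓ hℓ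
  refine ⟨1, pow_le_one₀ hη0.le hη1.le, i₁, fun i hi hL => ?_⟩
  have := hi₁ i hi
  linarith

/-- **Slow pinch under transparency** (stub 4″, the residual in sequence form): IF the far field is
transparent on every thin dyadic shape — for every `ℓ ≥ 1` and `δ > 0`, eventually in `i` the opened
configuration `(0, dn 2^{i+ℓ}, 2^i e₂, up 2^{i+ℓ})` has `U₄ > -δ·S(0,dn)S(2^i e₂,up)` (no far merging) —
THEN the adjacent-pinch avoidance decays slower than every exponential in the octave count:
`𝒜(e₂;2^i) ≥ c(η)·η^i` for every `η < 1` (pinch exponent zero). [folklore] -/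
def SlowPinchUnderTransparencyShape (S : Site 3 → Site 3 → ℝ) (F : (Fin 4 → Site 3) → ℝ) : Prop :=
  (∀ ℓ : ℕ, 1 ≤ ℓ → ∀ δ : ℝ, 0 < δ → ∃ i₁ : ℕ, ∀ i : ℕ, i₁ ≤ i →
      -(δ * (S 0 (dn (2 ^ (i + ℓ))) * S (src (2 ^ i)) (up (2 ^ (i + ℓ))))) <
        F ![0, dn (2 ^ (i + ℓ)), src (2 ^ i), up (2 ^ (i + ℓ))] -
          (S 0 (dn (2 ^ (i + ℓ))) * S (src (2 ^ i)) (up (2 ^ (i + ℓ))) +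
            S 0 (src (2 ^ i)) * S (dn (2 ^ (i + ℓ))) (up (2 ^ (i + ℓ))) +
            S 0 (up (2 ^ (i + ℓ))) * S (dn (2 ^ (i + ℓ))) (src (2 ^ i)))) →
    ∀ η : ℝ, 0 < η → η < 1 → ∃ c : ℝ, 0 < c ∧ ∃ i₀ : ℕ, ∀ i : ℕ, i₀ ≤ i → c * η ^ i ≤ avoidS S F e₂ (2 ^ i)

/-- **Thin far merging makes the slow pinch vacuous** (its transparency hypothesis fails). [folklore] -/
theorem slowPinch_of_thinFarMerging (h : ThinFarMergingShape S F) :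
    SlowPinchUnderTransparencyShape S F := by
  obtain ⟨ℓ, hℓ, δ, hδ, hio⟩ := h
  intro hT
  exfalso
  obtain ⟨i₁, hi₁⟩ := hT ℓ hℓ δ hδ
  obtain ⟨i, hi, hmerge⟩ := hio i₁
  have := hi₁ i hi
  linarith

/-- **Pinched transparency + strict positivity ⟹ slow pinch under transparency** (iterate the
conditional step along `ℓ`-blocks from a positive floor). [folklore] -/
theorem slowPinch_of_transparency (hP : SoftPackageNoBubble S T F) (hSPP : SinglePinchPositiveShape S F)
    (hPT : PinchedTransparencyShape S F) : SlowPinchUnderTransparencyShape S F := by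
  intro hT η hη0 hη1
  set A : ℕ → ℝ := fun i => avoidS S F e₂ (2 ^ i) with hA
  have hApos : ∀ i, 0 < A i := fun i =>
    div_pos (hSPP (2 ^ i) Nat.one_le_two_pow) (NparS_pos hP _ _)
  obtain ⟨ℓ₀, hℓ₀⟩ := hPT η hη0 hη1
  set ℓ : ℕ := max ℓ₀ 1 with hℓ_def
  have hℓ1 : 1 ≤ ℓ := le_max_right _ _
  obtain ⟨c, hcη, i₁, hpt⟩ := hℓ₀ ℓ (le_max_left _ _)
  have hηℓ : 0 < η ^ ℓ := pow_pos hη0 ℓ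
  have hc : 0 < c := lt_of_lt_of_le hηℓ hcη
  obtain ⟨i₂, hi₂⟩ := hT ℓ hℓ1 (1 / 2) (by norm_num)
  set I₀ : ℕ := max i₁ i₂ with hI₀
  have step : ∀ i, I₀ ≤ i → c * A i ≤ A (i + ℓ) := fun i hi =>
    hpt i ((le_max_left _ _).trans hi) (hi₂ i ((le_max_right _ _).trans hi))
  have iter : ∀ i, I₀ ≤ i → ∀ k : ℕ, c ^ k * A i ≤ A (i + k * ℓ) := by
    intro i hi k
    induction k with
    | zero => simp
    | succ k ih =>
      have hs := step (i + k * ℓ) (by omega)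
      rw [show i + (k + 1) * ℓ = i + k * ℓ + ℓ by ring]
      calc c ^ (k + 1) * A i = c * (c ^ k * A i) := by ring
        _ ≤ c * A (i + k * ℓ) := mul_le_mul_of_nonneg_left ih hc.le
        _ ≤ A (i + k * ℓ + ℓ) := hs
  obtain ⟨j₀, hj₀, hmin⟩ := Finset.exists_min_image (Finset.range ℓ) (fun j => A (I₀ + j))
    ⟨0, Finset.mem_range.2 (by omega)⟩
  set a₀ := A (I₀ + j₀) with ha₀
  have ha₀pos : 0 < a₀ := hApos _
  refine ⟨a₀, ha₀pos, I₀, fun i hi => ?_⟩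
  have hdecomp : i = I₀ + (i - I₀) % ℓ + (i - I₀) / ℓ * ℓ := by
    have := Nat.mod_add_div (i - I₀) ℓ
    rw [mul_comm] ; omega
  have hjlt : (i - I₀) % ℓ < ℓ := Nat.mod_lt _ (by omega)
  have h1 := iter (I₀ + (i - I₀) % ℓ) (by omega) ((i - I₀) / ℓ)
  rw [← hdecomp] at h1
  have h2 : a₀ ≤ A (I₀ + (i - I₀) % ℓ) := hmin _ (Finset.mem_range.2 hjlt)
  -- η^i ≤ η^{ℓ k} ≤ c^k with k = (i - I₀)/ℓ, since ℓ k ≤ i and η^ℓ ≤ c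
  have hkℓ : (i - I₀) / ℓ * ℓ ≤ i := (Nat.div_mul_le_self (i - I₀) ℓ).trans (by omega)
  have hηc : η ^ i ≤ c ^ ((i - I₀) / ℓ) :=
    calc η ^ i ≤ η ^ ((i - I₀) / ℓ * ℓ) := pow_le_pow_of_le_one hη0.le hη1.le hkℓ
      _ = (η ^ ℓ) ^ ((i - I₀) / ℓ) := by rw [mul_comm, pow_mul]
      _ ≤ c ^ ((i - I₀) / ℓ) := pow_le_pow_left₀ hηℓ.le hcη _
  calc a₀ * η ^ i ≤ a₀ * c ^ ((i - I₀) / ℓ) := mul_le_mul_of_nonneg_left hηc ha₀pos.le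
    _ = c ^ ((i - I₀) / ℓ) * a₀ := by ring
    _ ≤ c ^ ((i - I₀) / ℓ) * A (I₀ + (i - I₀) % ℓ) := mul_le_mul_of_nonneg_left h2 (by positivity)
    _ ≤ A i := h1

/-- **Slow pinch under transparency + single-pinch law ⟹ thin far merging** (no positivity, no
block iteration: if thin far merging fails the far field IS transparent, the pinch is then slower than
`r^{i/2}`, `r = 2^{-κ'}`, while the single-pinch law makes it `≤ C r^i` at the infinitely many good
scales). With `slowPinch_of_thinFarMerging`: MODULO THE SINGLE-PINCH LAW, ST ⟺ THIN FAR MERGING —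
the taxonomy bottoms out at the crux's own conclusion. [folklore] -/
theorem thinFarMerging_of_slowPinch (hP : SoftPackageNoBubble S T F) :
    SinglePinchLawShape S T F → SlowPinchUnderTransparencyShape S F → ThinFarMergingShape S F := by
  rintro ⟨κ', C, hκ', hspl⟩ hST
  by_contra hFM
  -- the far field is transparent on every thin dyadic shape
  have hT : ∀ ℓ : ℕ, 1 ≤ ℓ → ∀ δ : ℝ, 0 < δ → ∃ i₁ : ℕ, ∀ i : ℕ, i₁ ≤ i →
      -(δ * (S 0 (dn (2 ^ (i + ℓ))) * S (src (2 ^ i)) (up (2 ^ (i + ℓ))))) <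
        F ![0, dn (2 ^ (i + ℓ)), src (2 ^ i), up (2 ^ (i + ℓ))] -
          (S 0 (dn (2 ^ (i + ℓ))) * S (src (2 ^ i)) (up (2 ^ (i + ℓ))) +
            S 0 (src (2 ^ i)) * S (dn (2 ^ (i + ℓ))) (up (2 ^ (i + ℓ))) +
            S 0 (up (2 ^ (i + ℓ))) * S (dn (2 ^ (i + ℓ))) (src (2 ^ i))) := by
    intro ℓ hℓ δ hδ
    by_contra hne
    push Not at hne
    exact hFM ⟨ℓ, hℓ, δ, hδ, fun i₁ => by
      obtain ⟨i, hi, h⟩ := hne i₁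
      exact ⟨i, hi, h⟩⟩
  -- rates
  set r : ℝ := (2 : ℝ) ^ (-κ') with hr
  have hr0 : 0 < r := Real.rpow_pos_of_pos two_pos _
  have hr1 : r < 1 := Real.rpow_lt_one_of_one_lt_of_neg one_lt_two (by linarith)
  set η : ℝ := Real.sqrt r with hη
  have hη0 : 0 < η := Real.sqrt_pos.2 hr0
  have hη1 : η < 1 := by rw [hη, ← Real.sqrt_one]; exact Real.sqrt_lt_sqrt hr0.le hr1
  have hηr : η ^ 2 = r := Real.sq_sqrt hr0.le
  obtain ⟨c, hc, i₀, hlow⟩ := hST hT η hη0 hη1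
  set Cp : ℝ := max C 0 with hCp
  have hCp0 : 0 ≤ Cp := le_max_right _ _
  obtain ⟨N, hN⟩ := exists_pow_lt_of_lt_one (show 0 < c / (1024 * Cp + 1) by positivity) hη1
  obtain ⟨i, hiN, hgood⟩ := exists_good_scale hP (max i₀ N)
  have hi₀ : i₀ ≤ i := (le_max_left _ _).trans hiN
  have hiN' : N ≤ i := (le_max_right _ _).trans hiN
  -- upper bound at the good scale
  have hup : avoidS S F e₂ (2 ^ i) ≤ 1024 * Cp * r ^ i := by
    have h := avoidS_dyadic_le hP hspl i
    have hb3 : 0 < S 0 (Pi.single 0 ((2 ^ (i + 3) : ℕ) : ℤ)) := hP.pos _ _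
    have hb1 : 0 ≤ S 0 (Pi.single 0 ((2 ^ (i + 1) : ℕ) : ℤ)) := (hP.pos _ _).le
    have hratio : S 0 (Pi.single 0 ((2 ^ (i + 1) : ℕ) : ℤ)) ^ 2 /
        S 0 (Pi.single 0 ((2 ^ (i + 3) : ℕ) : ℤ)) ^ 2 ≤ 1024 := by
      rw [div_le_iff₀ (by positivity)]
      nlinarith [mul_le_mul hgood hgood hb1 (by positivity)]
    have hri : r ^ (i + 1) ≤ r ^ i := pow_le_pow_of_le_one hr0.le hr1.le (Nat.le_succ i)
    calc avoidS S F e₂ (2 ^ i) ≤ Cp * r ^ (i + 1) * S 0 (Pi.single 0 ((2 ^ (i + 1) : ℕ) : ℤ)) ^ 2 /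
          S 0 (Pi.single 0 ((2 ^ (i + 3) : ℕ) : ℤ)) ^ 2 := h
      _ = Cp * r ^ (i + 1) * (S 0 (Pi.single 0 ((2 ^ (i + 1) : ℕ) : ℤ)) ^ 2 /
          S 0 (Pi.single 0 ((2 ^ (i + 3) : ℕ) : ℤ)) ^ 2) := by ring
      _ ≤ Cp * r ^ (i + 1) * 1024 := mul_le_mul_of_nonneg_left hratio (by positivity)
      _ ≤ Cp * r ^ i * 1024 := by
          have := mul_le_mul_of_nonneg_left hri hCp0
          nlinarith
      _ = 1024 * Cp * r ^ i := by ring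
  -- lower bound c η^i, and r^i = η^i η^i with η^i ≤ η^N < c/(1024 Cp + 1)
  have hlo := hlow i hi₀
  have hηi : η ^ i ≤ η ^ N := pow_le_pow_of_le_one hη0.le hη1.le hiN'
  have hηi0 : 0 < η ^ i := pow_pos hη0 i
  have hri : r ^ i = η ^ i * η ^ i := by rw [← hηr, ← pow_mul, mul_comm 2 i, pow_mul, sq]
  have key : c * η ^ i ≤ 1024 * Cp * (η ^ i * η ^ i) := by rw [← hri]; exact hlo.trans hup
  have key' : c ≤ 1024 * Cp * η ^ i := by
    have := le_of_mul_le_mul_right (by nlinarith [key] : c * η ^ i ≤ (1024 * Cp * η ^ i) * η ^ i) hηi0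
    exact this
  have hN' : η ^ N * (1024 * Cp + 1) < c := by rwa [lt_div_iff₀ (by positivity)] at hN
  nlinarith [mul_le_mul_of_nonneg_left hηi (by positivity : (0 : ℝ) ≤ 1024 * Cp), pow_pos hη0 N]

/-- **Slow pinch under transparency + single-pinch law ⟹ far merging.** [folklore] -/
theorem farMerging_of_slowPinch (hP : SoftPackageNoBubble S T F) (h1 : SinglePinchLawShape S T F)
    (h2 : SlowPinchUnderTransparencyShape S F) : FarMergingShape S F :=
  farMerging_of_thinFarMerging (thinFarMerging_of_slowPinch hP h1 h2)

/-- **Modulo the single-pinch law, the slow pinch IS thin far merging.** [folklore] -/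
theorem slowPinch_iff_thinFarMerging (hP : SoftPackageNoBubble S T F) (h1 : SinglePinchLawShape S T F) :
    SlowPinchUnderTransparencyShape S F ↔ ThinFarMergingShape S F :=
  ⟨thinFarMerging_of_slowPinch hP h1, slowPinch_of_thinFarMerging⟩

/-- The transparent iteration, refactored through the slow pinch. [folklore] -/
theorem scaleIteration_soft_transparent' (hP : SoftPackageNoBubble S T F) :
    SinglePinchLawShape S T F → SinglePinchPositiveShape S F → PinchedTransparencyShape S F →
      FarMergingShape S F :=
  fun h1 h2 h3 => farMerging_of_slowPinch hP h1 (slowPinch_of_transparency hP h2 h3)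

end shapes

/-! ## Pinched transparency is not soft: family A′ -/

section noGo

/-- **A′ violates pinched transparency** — by the transparent iteration itself, since A′ has the
single-pinch law, strict positivity and no far merging (directly: on `Th(2^ℓ)·2^i` family A′ does not
merge, `θ_{A′} → 0`, while `𝒜_{A′}(e₂;2^{i+ℓ})/𝒜_{A′}(e₂;2^i) = (q_{2^{i+ℓ}}/q_{2^i})² ≈ 4^{-ℓ}`). [folklore] -/
theorem not_pinchedTransparency_A' : ¬ PinchedTransparencyShape S₀ FA' := fun h =>
  not_farMergingShape_A'
    (scaleIteration_soft_transparent softPackageNoBubble_A' singlePinchLawShape_A'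
      singlePinchPositiveShape_A' h)

/-- **Stub 4′ is not soft**: no argument from the 22-field soft package + GAP + the isosceles RP
minors + the un-pinched envelope + the single-pinch law + strict single-pinch positivity proves
pinched transparency. The model enters — but only in the transparent (non-merging) regime. [folklore] -/
theorem pinchedTransparency_false_without_model :
    ¬ ∀ (S : Site 3 → Site 3 → ℝ) (T : Site 3 → ℝ) (F : (Fin 4 → Site 3) → ℝ),
      SoftPackage S T F → GapShape S T F → RPUnpinchIsoShape S F → UnpinchedEnvelopeShape S T F →
        SinglePinchLawShape S T F → SinglePinchPositiveShape S F → PinchedTransparencyShape S F :=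
  fun h => not_pinchedTransparency_A' (h S₀ T₀ FA' softPackage_A' gapShape_A'
    rpUnpinchIsoShape_A' unpinchedEnvelopeShape_A' singlePinchLawShape_A' singlePinchPositiveShape_A')

/-- **A′ violates the slow pinch under transparency** (A′ is transparent and its pinch is `2q² ≍ 4^{-i}`). [folklore] -/
theorem not_slowPinch_A' : ¬ SlowPinchUnderTransparencyShape S₀ FA' := fun h =>
  not_farMergingShape_A' (farMerging_of_slowPinch softPackageNoBubble_A' singlePinchLawShape_A' h)

/-- **Stub 4″ is not soft** either. [folklore] -/
theorem slowPinch_false_without_model :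
    ¬ ∀ (S : Site 3 → Site 3 → ℝ) (T : Site 3 → ℝ) (F : (Fin 4 → Site 3) → ℝ),
      SoftPackage S T F → GapShape S T F → RPUnpinchIsoShape S F → UnpinchedEnvelopeShape S T F →
        SinglePinchLawShape S T F → SinglePinchPositiveShape S F → SlowPinchUnderTransparencyShape S F :=
  fun h => not_slowPinch_A' (h S₀ T₀ FA' softPackage_A' gapShape_A'
    rpUnpinchIsoShape_A' unpinchedEnvelopeShape_A' singlePinchLawShape_A' singlePinchPositiveShape_A')

end noGo

/-! ## The Ising instance: the crux is closed modulo pinched transparency -/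

section ising

/-- Pinched transparency at the critical correlators, spelled out over tree vocabulary (the text of
the candidate stub 4′ for the lead; `Iff.rfl`). With `up m = (2m,m,0)`, `dn m = (2m,-m,0)`,
`𝒜(e₂;m) = ⟨σ₀σ_{e₂} ; σ_{up m}σ_{dn m}⟩/(⟨σ₀σ_{dn m}⟩⟨σ_{e₂}σ_{up m}⟩)`. [folklore] -/
theorem pinchedTransparencyShape_criticalCorr_iff :
    PinchedTransparencyShape cc2 (criticalCorr 3 4) ↔
      ∀ η : ℝ, 0 < η → η < 1 → ∃ ℓ₀ : ℕ, ∀ ℓ : ℕ, ℓ₀ ≤ ℓ → ∃ c : ℝ, η ^ ℓ ≤ c ∧ ∃ i₁ : ℕ, ∀ i : ℕ, i₁ ≤ i →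
        -(1 / 2 * (criticalCorr 3 2 ![0, dn (2 ^ (i + ℓ))] * criticalCorr 3 2 ![src (2 ^ i), up (2 ^ (i + ℓ))])) <
            criticalCorr 3 4 ![0, dn (2 ^ (i + ℓ)), src (2 ^ i), up (2 ^ (i + ℓ))] -
              (criticalCorr 3 2 ![0, dn (2 ^ (i + ℓ))] * criticalCorr 3 2 ![src (2 ^ i), up (2 ^ (i + ℓ))] +
                criticalCorr 3 2 ![0, src (2 ^ i)] * criticalCorr 3 2 ![dn (2 ^ (i + ℓ)), up (2 ^ (i + ℓ))] +
                criticalCorr 3 2 ![0, up (2 ^ (i + ℓ))] * criticalCorr 3 2 ![dn (2 ^ (i + ℓ)), src (2 ^ i)]) →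
          c * ((criticalCorr 3 4 ![0, e₂, up (2 ^ i), dn (2 ^ i)] -
                  criticalCorr 3 2 ![0, e₂] * criticalCorr 3 2 ![up (2 ^ i), dn (2 ^ i)]) /
                (criticalCorr 3 2 ![0, dn (2 ^ i)] * criticalCorr 3 2 ![e₂, up (2 ^ i)])) ≤
            (criticalCorr 3 4 ![0, e₂, up (2 ^ (i + ℓ)), dn (2 ^ (i + ℓ))] -
                criticalCorr 3 2 ![0, e₂] * criticalCorr 3 2 ![up (2 ^ (i + ℓ)), dn (2 ^ (i + ℓ))]) /
              (criticalCorr 3 2 ![0, dn (2 ^ (i + ℓ))] * criticalCorr 3 2 ![e₂, up (2 ^ (i + ℓ))]) :=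
  Iff.rfl

/-- The transparent scale iteration at the critical correlators of `ℤ³`. [folklore] -/
theorem scaleIteration_transparent_criticalCorr :
    SinglePinchLawShape cc2 (criticalTwoPoint 3) (criticalCorr 3 4) →
      SinglePinchPositiveShape cc2 (criticalCorr 3 4) →
        PinchedTransparencyShape cc2 (criticalCorr 3 4) → FarMergingShape cc2 (criticalCorr 3 4) :=
  scaleIteration_soft_transparent softPackageNoBubble_criticalCorr

/-- **The crux reduces to pinched transparency alone**: with stubs 1 (isosceles RP minors), 2
(envelope, inside `singlePinchLawShape_of_gap`) and 3 (strict positivity) landed,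
`PinchedTransparencyShape cc2 (criticalCorr 3 4) → GapForcesFarMerging`. [folklore] -/
theorem gapForcesFarMerging_of_transparency
    (h4 : PinchedTransparencyShape cc2 (criticalCorr 3 4)) : GapForcesFarMerging := by
  rw [crux_iff_shapes]
  intro hGAP
  exact scaleIteration_transparent_criticalCorr (singlePinchLawShape_of_gap hGAP)
    singlePinchPositiveShape_criticalCorr h4

/-- **The crux reduces to the slow pinch under transparency** — WITHOUT strict positivity:
`SlowPinchUnderTransparencyShape cc2 (criticalCorr 3 4) → GapForcesFarMerging` (stub 1's isosceles
instances and stub 2 inside `singlePinchLawShape_of_gap`; GAP consumed once). In words: it suffices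
to show that IF the critical four-point function is asymptotically Gaussian on the thin dyadic shapes
THEN the adjacent-pinch avoidance `⟨σ₀σ_{e₂} ; σ_{up 2^i}σ_{dn 2^i}⟩/(⟨σ₀σ_{dn}⟩⟨σ_{e₂}σ_{up}⟩)` has
exponent zero. [folklore] -/
theorem gapForcesFarMerging_of_slowPinch
    (h4 : SlowPinchUnderTransparencyShape cc2 (criticalCorr 3 4)) : GapForcesFarMerging := by
  rw [crux_iff_shapes]
  intro hGAP
  exact farMerging_of_slowPinch softPackageNoBubble_criticalCorr (singlePinchLawShape_of_gap hGAP) h4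

/-- The slow pinch at the critical correlators, spelled out over tree vocabulary (the text of the
candidate stub 4″; `Iff.rfl`). [folklore] -/
theorem slowPinchUnderTransparencyShape_criticalCorr_iff :
    SlowPinchUnderTransparencyShape cc2 (criticalCorr 3 4) ↔
      ((∀ ℓ : ℕ, 1 ≤ ℓ → ∀ δ : ℝ, 0 < δ → ∃ i₁ : ℕ, ∀ i : ℕ, i₁ ≤ i →
          -(δ * (criticalCorr 3 2 ![0, dn (2 ^ (i + ℓ))] * criticalCorr 3 2 ![src (2 ^ i), up (2 ^ (i + ℓ))])) <
            criticalCorr 3 4 ![0, dn (2 ^ (i + ℓ)), src (2 ^ i), up (2 ^ (i + ℓ))] -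
              (criticalCorr 3 2 ![0, dn (2 ^ (i + ℓ))] * criticalCorr 3 2 ![src (2 ^ i), up (2 ^ (i + ℓ))] +
                criticalCorr 3 2 ![0, src (2 ^ i)] * criticalCorr 3 2 ![dn (2 ^ (i + ℓ)), up (2 ^ (i + ℓ))] +
                criticalCorr 3 2 ![0, up (2 ^ (i + ℓ))] * criticalCorr 3 2 ![dn (2 ^ (i + ℓ)), src (2 ^ i)])) →
        ∀ η : ℝ, 0 < η → η < 1 → ∃ c : ℝ, 0 < c ∧ ∃ i₀ : ℕ, ∀ i : ℕ, i₀ ≤ i →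
          c * η ^ i ≤ (criticalCorr 3 4 ![0, e₂, up (2 ^ i), dn (2 ^ i)] -
                criticalCorr 3 2 ![0, e₂] * criticalCorr 3 2 ![up (2 ^ i), dn (2 ^ i)]) /
              (criticalCorr 3 2 ![0, dn (2 ^ i)] * criticalCorr 3 2 ![e₂, up (2 ^ i)])) :=
  Iff.rfl

end ising


/-! ## Family E passes pinched transparency (vacuously: its thin shapes merge at every scale) -/

section transparencyE

/-- **E satisfies pinched transparency**: on every `Th(2^ℓ)·2^i`, `i ≥ 1`, family E MERGES
(`thinMerging_E`: `U₄ = -⟨σσ⟩⟨σσ⟩ < -½⟨σσ⟩⟨σσ⟩`), so the conditional statement is never invoked —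
consistent with E's far merging, and in contrast with its failure of (dyadic) quasi-multiplicativity. [folklore] -/
theorem pinchedTransparency_E : PinchedTransparencyShape S₀ FE := by
  intro η hη0 hη1
  refine ⟨0, fun ℓ _ => ⟨1, pow_le_one₀ hη0.le hη1.le, 1, fun i hi hL => ?_⟩⟩
  exfalso
  have hs2 : 2 ≤ 2 ^ i :=
    calc 2 = 2 ^ 1 := (pow_one 2).symm
      _ ≤ 2 ^ i := Nat.pow_le_pow_right (by norm_num) hi
  have hsm : 2 ^ i ≤ 2 ^ (i + ℓ) := Nat.pow_le_pow_right (by norm_num) (by omega)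
  have hm1 : 1 ≤ 2 ^ (i + ℓ) := Nat.one_le_two_pow
  rw [thinMerging_E hm1 hs2 hsm] at hL
  have hpos : 0 < S₀ 0 (dn (2 ^ (i + ℓ))) * S₀ (src (2 ^ i)) (up (2 ^ (i + ℓ))) :=
    mul_pos (S₀_pos _ _) (S₀_pos _ _)
  linarith

/-- The witness, packaged: ALL soft inputs of the line, far merging AND pinched transparency, without
quasi-multiplicativity (uniform or dyadic) — stub 4′ separates from stub 4 exactly on the converse side. [folklore] -/
theorem lineInputs_with_farMerging_and_transparency_without_QM :
    ∃ (S : Site 3 → Site 3 → ℝ) (T : Site 3 → ℝ) (F : (Fin 4 → Site 3) → ℝ),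
      SoftPackage S T F ∧ GapShape S T F ∧ RPUnpinchIsoShape S F ∧ UnpinchedEnvelopeShape S T F ∧
        SinglePinchLawShape S T F ∧ SinglePinchPositiveShape S F ∧ FarMergingShape S F ∧
        PinchedTransparencyShape S F ∧ ¬ QuasiMultiplicativeShape S F ∧ ¬ QuasiMultiplicativeDyadicShape S F :=
  ⟨S₀, T₀, FE, softPackage_E, gapShape_E, rpUnpinchIsoShape_E, unpinchedEnvelopeShape_E,
    singlePinchLawShape_E, singlePinchPositiveShape_E, farMergingShape_E, pinchedTransparency_E,
    not_quasiMultiplicativeShape_E, not_quasiMultiplicativeDyadicShape_E⟩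

/-- **E satisfies the slow pinch under transparency** (vacuously: E is not transparent). [folklore] -/
theorem slowPinch_E : SlowPinchUnderTransparencyShape S₀ FE := by
  intro hT
  exfalso
  obtain ⟨i₁, h⟩ := hT 1 le_rfl (1 / 2) (by norm_num)
  set i : ℕ := max i₁ 1 with hi_def
  have hL := h i (le_max_left _ _)
  have hs2 : 2 ≤ 2 ^ i :=
    calc 2 = 2 ^ 1 := (pow_one 2).symm
      _ ≤ 2 ^ i := Nat.pow_le_pow_right (by norm_num) (le_max_right _ _)
  have hsm : 2 ^ i ≤ 2 ^ (i + 1) := Nat.pow_le_pow_right (by norm_num) (by omega)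
  have hm1 : 1 ≤ 2 ^ (i + 1) := Nat.one_le_two_pow
  rw [thinMerging_E hm1 hs2 hsm] at hL
  have hpos : 0 < S₀ 0 (dn (2 ^ (i + 1))) * S₀ (src (2 ^ i)) (up (2 ^ (i + 1))) :=
    mul_pos (S₀_pos _ _) (S₀_pos _ _)
  linarith

/-- **E merges eventually at every aspect ratio** (indeed at every `ℓ ≥ 0`, `i ≥ 1`, with `U₄ = -GG`). [folklore] -/
theorem eventualMerging_E : EventualMergingShape S₀ FE := by
  refine ⟨0, fun ℓ _ => ⟨1, fun i hi => ?_⟩⟩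
  have hs2 : 2 ≤ 2 ^ i :=
    calc 2 = 2 ^ 1 := (pow_one 2).symm
      _ ≤ 2 ^ i := Nat.pow_le_pow_right (by norm_num) hi
  have hsm : 2 ^ i ≤ 2 ^ (i + ℓ) := Nat.pow_le_pow_right (by norm_num) (by omega)
  have hm1 : 1 ≤ 2 ^ (i + ℓ) := Nat.one_le_two_pow
  rw [thinMerging_E hm1 hs2 hsm]
  have hpos : 0 < S₀ 0 (dn (2 ^ (i + ℓ))) * S₀ (src (2 ^ i)) (up (2 ^ (i + ℓ))) :=
    mul_pos (S₀_pos _ _) (S₀_pos _ _)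
  linarith

/-- E has thin far merging. [folklore] -/
theorem thinFarMerging_E : ThinFarMergingShape S₀ FE := thinFarMerging_of_eventualMerging eventualMerging_E

/-- A′ has no thin far merging. [folklore] -/
theorem not_thinFarMerging_A' : ¬ ThinFarMergingShape S₀ FA' := fun h =>
  not_farMergingShape_A' (farMerging_of_thinFarMerging h)

/-- **Summary of generation 4 (one theorem).** The chain of sufficient replacements for stub 4,
`QM ⟹ QMdyadic ⟹ PT ⟹(SPP) ST ⟺(SPL) ThinFarMerging`, each closing the crux with the landed stubs,
each NOT soft (A′), separated by family E exactly between the unconditional and the conditional forms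
(E has every line input and far merging, fails QM and QMdyadic, passes PT and ST), bottoming out at
the conclusion (ST ⟺ thin far merging modulo the single-pinch law) and vacuous under the expected
eventual merging (EM ⟹ PT). [folklore] -/
theorem stub4_taxonomy :
    -- sufficiency (Ising, landed stubs discharged)
    (QuasiMultiplicativeShape cc2 (criticalCorr 3 4) → GapForcesFarMerging) ∧
    (QuasiMultiplicativeDyadicShape cc2 (criticalCorr 3 4) → GapForcesFarMerging) ∧
    (PinchedTransparencyShape cc2 (criticalCorr 3 4) → GapForcesFarMerging) ∧
    (SlowPinchUnderTransparencyShape cc2 (criticalCorr 3 4) → GapForcesFarMerging) ∧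
    -- implications over the package
    (∀ (S : Site 3 → Site 3 → ℝ) (T : Site 3 → ℝ) (F : (Fin 4 → Site 3) → ℝ), SoftPackageNoBubble S T F →
      (QuasiMultiplicativeShape S F → QuasiMultiplicativeDyadicShape S F) ∧
      (QuasiMultiplicativeDyadicShape S F → PinchedTransparencyShape S F) ∧
      (SinglePinchPositiveShape S F → PinchedTransparencyShape S F → SlowPinchUnderTransparencyShape S F) ∧
      (SinglePinchLawShape S T F → (SlowPinchUnderTransparencyShape S F ↔ ThinFarMergingShape S F)) ∧
      (EventualMergingShape S F → PinchedTransparencyShape S F)) ∧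
    -- none is soft
    (¬ QuasiMultiplicativeShape S₀ FA' ∧ ¬ QuasiMultiplicativeDyadicShape S₀ FA' ∧
      ¬ PinchedTransparencyShape S₀ FA' ∧ ¬ SlowPinchUnderTransparencyShape S₀ FA') ∧
    -- family E separates
    (FarMergingShape S₀ FE ∧ ¬ QuasiMultiplicativeShape S₀ FE ∧ ¬ QuasiMultiplicativeDyadicShape S₀ FE ∧
      PinchedTransparencyShape S₀ FE ∧ SlowPinchUnderTransparencyShape S₀ FE) :=
  ⟨gapForcesFarMerging_of_quasiMultiplicative, gapForcesFarMerging_of_quasiMultiplicativeDyadic,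
    gapForcesFarMerging_of_transparency, gapForcesFarMerging_of_slowPinch,
    fun _ _ _ hP => ⟨qmDyadic_of_qm, transparency_of_qmDyadic hP, slowPinch_of_transparency hP,
      slowPinch_iff_thinFarMerging hP, pinchedTransparency_of_eventualMerging⟩,
    ⟨not_quasiMultiplicativeShape_A', not_quasiMultiplicativeDyadicShape_A', not_pinchedTransparency_A',
      not_slowPinch_A'⟩,
    ⟨farMergingShape_E, not_quasiMultiplicativeShape_E, not_quasiMultiplicativeDyadicShape_E,
      pinchedTransparency_E, slowPinch_E⟩⟩

end transparencyE


/-! # §8 The reflection-positivity question, numerically (generation 3) — prose only, no declarations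

QUESTION (gen 2's "next, sharper no-go"): is there a soft family with GAP and no far merging that
is compatible with reflection positivity — at least with every RP–Cauchy–Schwarz inequality the
line's lever can write down (energy row × pair rows across site planes, `RPUnpinchShape`, and
more generally positive semi-definiteness of the reflected Gram matrix
`M[(a,b),(c,d)] = F(θa,θb,c,d) − S(θa,θb)S(c,d)` on ALL pair observables of a half-space)?

FINDINGS (scripts `rpscan_pure.py`, `rp3scan.py` in the seat folder; kit jobs `j008255` (full
2×2 scan, `m ≤ 8`, targets in `[m,m+6]×[-6,6]²`) and `j008428` (minimum eigenvalue of `M` on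
half-boxes) queued at the time of writing — their JSON summaries are attached to the item when done):

* SUP-NORM families (this file's `S₀`): family A violates `RPUnpinchShape` outright
  (`familyA_not_rpCauchySchwarz`, the GAP entry vanishes on the axis); A′ (§7) and the
  `1/(1+diam)` variant satisfy the ISOSCELES minors (`rpUnpinchIsoShape_A'`, proved) but violate
  other instances by factors ≤ 4.5 resp. 2.7 (e.g. A′: `m = 2`, `y = (3,-3,-3)`, `z = (4,-3,-3)`:
  LHS `1.74e-4` vs RHS `3.2e-3 × 1.2e-2 = 3.8e-5`), always at small near-plane configurations with adjacent targets.
* ℓ¹-NORM families (kernel `S₁(a,b) = 1/(1+|b−a|₁)`, same `F = Wick − 2·Pmin·θ`, `θ_A = 1/max(1,sep₁)`):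
  families A, A′, Ad satisfy ALL 2×2 minors of `RPUnpinchShape` for `m ≤ 5`, targets in
  `[m,m+4]×[-4,4]²` — 984,150 instances each, ZERO violations; the worst non-trivial ratio
  LHS/RHS for A is `0.852, 0.929, 0.929, 0.958` at `m = 1,2,3,4`, attained at the reversed bond one
  step before the mirror image, `((2m−1,1,0),(2m−1,0,0))` — the inequality is asymptotically TIGHT
  there, so any proof must be sharp near the diagonal. Random 3×3 minors (bond + two pair rows),
  80,000 samples, `m ≤ 3`: zero violations for the Wick family and for A over `S₁`.
* WHY ℓ¹: `1/(1+t) = ∫₀^∞ e^{-s(1+t)} ds` and on the half-space `{x₀ ≥ m}`,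
  `|c − θa|₁ = (c₀−m) + (a₀−m) + |c⊥ − a⊥|₁`, so `K(a,c) = S₁(θa,c) = ∫ e^{-s}·e^{-s u(a)}e^{-s u(c)}·
  ∏ᵢ e^{-s|aᵢ−cᵢ|} ds` is positive semi-definite (rank one × Schur products of Laplace kernels):
  the ℓ¹ kernel is a REFLECTION-POSITIVE two-point function (indeed the covariance of an RP
  Gaussian lattice field), and the Wick part of `M` is PSD. The sup-norm kernel has no such
  representation. The deformation `−2·Pmin·θ_A` is what creates GAP; numerically it does not
  destroy positivity in the pair sector.
* Over `S₁`, family A keeps the whole soft package (the kernel lemmas go through: `|x|₁ ≤ 3‖x‖_∞`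
  gives `lower`, `‖·‖_∞ ≤ |·|₁` gives `upper` and `mms`, the planar series gives `bubble`), GAP with
  `κ = 1` (`|g(x)² − g(x+e₂)g(x−e₂)| ≤ 3|x|₁⁻¹ g(x)²`), STRICT single-pinch positivity
  (`T_A(e₂;m) = P₃ − P₂ = 2/((1+3m)·3m·(3m+2)) > 0`), the single-pinch law with `κ' = 1`, no far
  merging, and — by `scaleIteration_soft` — violates quasi-multiplicativity.

CONJECTURE (sharper no-go, barrier-candidate "pair-sector RP is blind to quasi-multiplicativity"):
family A over the ℓ¹ kernel satisfies every RP–Cauchy–Schwarz inequality among pair observables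
across site planes (PSD of `M` on the pair sector). If true: NO deployment of reflection positivity
on pair observables (the lever of cards rp-unpinch-single-passage, rp-gram-halving,
rp-schwarz-single-pinch), combined with the soft package and GAP, proves `QuasiMultiplicative`
or the crux; the lattice coupling of stub 4 must come from the current representation (switching,
sourced-current separation) or from RP with observables outside the pair sector. Not formalised:
the family's package/GAP/SPL/SPP/¬QM/¬FM are routine (as for A′) but the RP property itself has only
the numerical evidence above.
-/

end Summit.CriticalPhenomena.Ising3DConformalLimit.Cruxes.GapForcesFarMerging.Disproof

end
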